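import Literature.Barriers.CriticalPhenomena.NienhuisWeightsExcludeVertexSAW
import HarnessLib

/-!
# Barrier `NienhuisWeightsExcludeVertexSAW` — Appendix B (second audit): the technique class is empty already on compact star-shaped domains

Companion module of `Literature/Barriers/CriticalPhenomena/NienhuisWeightsExcludeVertexSAW.lean`
(barrier catalogue, D-0021; sub-problem `SAWScalingLimit`). It is NOT a separate barrier entry: it
strengthens the audit appendix of that file (kept apart only because of the gate's file-size cap).

Appendix A there proves `not_hasExactVertexRelationZ2 : ¬ HasExactVertexRelationZ2` — the uniform
square-lattice SAW mid-edge observable `Literature.Probability.RandomPlanarGeometry.SAW.midEdgeParafermionicObservable`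
satisfies no exact 4-term vertex relation `Σᵢ cᵢ F({v, v+dirᵢ}) = 0` with vertex-independent `c ≠ 0`
at any `x ∈ (0,1)`, `σ` — by instantiating the relation on the plus-shaped domain and on two domains
WITH HOLES (`T`, `O`: lattice cycles around absent sites), leaving open (its `scope_caveats` (a))
whether the obstruction survives when the relation is only demanded on simply connected domains.

This file settles it: the named fact **`NoExactVertexRelationZ2SC`** (negative form: no `x, σ, c ≠ 0`
with the relation on all discrete domains `Ω_δ` cut out by COMPACT plane sets `Ω` STAR-SHAPED about
the point `δv`, hence simply connected) is PROVED (`NoExactVertexRelationZ2SC_holds`). Since the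
relation is asked of fewer domains, this is the stronger statement: Appendix A's theorem follows
from it (`not_hasExactVertexRelationZ2_of_SC`). (`HasExactVertexRelationZ2` — the technique class
in inhabited form, a refuted statement and not a named fact — is a `@[deprecated]` record of the
parent module since the verdict clean-up of 2026-08-16; this file names it in that theorem only.)

## Proof

* **Good domains.** `GoodDomain Ω E`: a plane set whose integer points and mesh-graph adjacency at
  mesh `1` are those of an edge list `E` (the segment unions `Omega E` of Appendix A are examples,
  `GoodEdgeList.goodDomain`); the walk-enumeration machinery of Appendix A (`dfs` completeness,
  `decide` certificates) is re-derived for them (`GoodDomain.support_mem_dfs`).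
* **Boxes with pendant edges.** `BoxPend m₁ m₂ n₁ n₂ P = [m₁,m₂]×[n₁,n₂] ∪ Omega P` is compact,
  star-shaped about `0` when the box contains `0` and every pendant edge ends at `0`
  (`starConvex_BoxPend`), and is a good domain for the explicit dart list (`goodDomain_BoxPend`: a
  unit lattice segment lies in it iff both ends are in the box or it is a pendant — midpoint
  criterion, `seg_subset_BoxPend_iff`).
* **Instances** (root the leaf `E = (1,0)`, stencil vertex `v = 0`, `t = e^{-iσπ/2}`): the plus `P`
  with its four roots (Appendix A's values `F_P_*`, its set `Omega PE` being compact and star-shaped);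
  `Q = [-1,0]×[0,1]` with pendants `v–E`, `S–v`: row `(x, x²t⁻¹ + x⁵t⁻³, x² + x⁵t², x²t)`; its
  mirror image `Q̄ = [-1,0]×[-1,0]` with pendants `v–E`, `v–N`: row
  `(x, x²t⁻¹, x² + x⁵t⁻², x²t + x⁵t³)`; the rectangle `O₂ = [-1,0]×[-1,1]` with pendant `v–E`:
  row `(x, x²t⁻¹ + (x⁵+x⁷)t⁻³, x² + x⁵(t²+t⁻²), x²t + (x⁵+x⁷)t³)` (some half-edge terms now
  carry two walks: `halfEdgeTerm_eq_pair`). Subtracting the plus row, `Q` and `Q̄` give `x⁵` times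
  the adjacent-return rows `(0,t⁻³,t²,0)·c`, `(0,0,t⁻²,t³)·c`, and `O₂ − x⁵·(both)` gives `x⁷`
  times the opposite-return row `(0,t⁻³,0,t³)·c` — exactly the `T`- and `O`-row hypotheses of
  Appendix A's `vertexStencil_eq_zero_of_rows`, which ends the proof.
* Numerically (floating point, not formalised) the seven instances are nearly dependent at
  `σ ≈ 0.6053`, `x ≈ 0.38058` (smallest relative singular value `4.7·10⁻⁴`): the local face of
  the inexact square-lattice identities of Beaton–Guttmann–Jensen, not an exact relation.
  [cite: BeatonGuttmannJensen2012, p. 5]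
-/

noncomputable section

open Real

namespace Literature.Barriers.CriticalPhenomena

open Literature.Probability.RandomPlanarGeometry.SAW.YangBaxter Literature.Probability.LatticeModels Literature.Probability.Percolation

section StarConvexEmpty

open Complex ComplexConjugate

namespace NoVertexRelation

variable {E : List (ZZ × ZZ)}

/-! ### Half-edge terms with two contributing walks -/

open Literature.Probability.RandomPlanarGeometry.SAW in
/-- A half-edge term with exactly two contributing walks `γ₁ ≠ γ₂` (every other SAW to `z` has used
the edge `{z, w}`) is the sum of their two summands. [folklore] -/
theorem halfEdgeTerm_eq_pair {Ω : Set ℂ} {δ : ℝ} {a z : Site 2} (x σ : ℝ) (w : Site 2)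
    (γ₁ γ₂ : DomainSAW Ω δ a z) (hne : γ₁ ≠ γ₂)
    (h : ∀ γ : DomainSAW Ω δ a z, γ ≠ γ₁ → γ ≠ γ₂ → s(z, w) ∈ γ.walk.edges) :
    halfEdgeTerm Ω δ a x σ z w =
      (if s(z, w) ∈ γ₁.walk.edges then 0 else
        Complex.exp (-Complex.I * σ *
            (Literature.Probability.LatticeModels.winding (γ₁.walk.support.map (meshPoint δ) ++ [medialPoint δ s(z, w)]) : ℝ)) *
          (x : ℂ) ^ (γ₁.length + 1)) +
      (if s(z, w) ∈ γ₂.walk.edges then 0 else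
        Complex.exp (-Complex.I * σ *
            (Literature.Probability.LatticeModels.winding (γ₂.walk.support.map (meshPoint δ) ++ [medialPoint δ s(z, w)]) : ℝ)) *
          (x : ℂ) ^ (γ₂.length + 1)) := by
  classical
  unfold halfEdgeTerm
  rw [tsum_eq_sum (s := {γ₁, γ₂}) (fun γ hγ => if_pos (h γ ?_ ?_)), Finset.sum_pair hne]
  · exact fun h1 => hγ (by simp [h1])
  · exact fun h2 => hγ (by simp [h2])

/-! ### Plane sets with a prescribed discrete structure -/

/-- A plane set `Ω` whose discrete structure at mesh `1` is that of the (unit-dart, connected)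
edge list `E`: integer points of `Ω` = `verts E`, mesh-graph adjacency = `E`. [folklore] -/
structure GoodDomain (Ω : Set ℂ) (E : List (ZZ × ZZ)) : Prop where
  unit : ∀ e ∈ E, IsUnitDart e
  memV : ∀ s : Site 2, s ∈ meshVertices Ω 1 ↔ ofSite s ∈ verts E
  adjG : ∀ s t : Site 2, (meshGraph Ω 1).Adj s t ↔ EAdj E (ofSite s) (ofSite t)
  conn : ∃ r ∈ verts E, ∃ fuel : ℕ, ∀ p ∈ verts E, ∃ l ∈ dfs E fuel [r], p ∈ l

/-- The segment-union domain of a good edge list is a good domain (consistency with Appendix A). [folklore] -/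
theorem GoodEdgeList.goodDomain (hG : GoodEdgeList E) : GoodDomain (Omega E) E :=
  ⟨hG.unit, mem_meshVertices_Omega_iff hG.unit, meshGraph_adj_iff' hG.unit, hG.conn⟩

variable {Ω : Set ℂ}

/-- Integer points of a good domain. [folklore] -/
theorem GoodDomain.pt_mem_iff (hG : GoodDomain Ω E) (r : ZZ) : pt r ∈ Ω ↔ r ∈ verts E := by
  rw [← meshPoint_one_toSite, ← Literature.Probability.LatticeModels.mem_meshVertices_iff (δ := 1), hG.memV,
    ofSite_toSite]

/-- Reachability from `r` to `q` inside the mesh-vertex graph of `Ω`, for integer points. [folklore] -/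
def ReachIn (Ω : Set ℂ) (r q : ZZ) : Prop :=
  ∃ (hr : toSite r ∈ meshVertices Ω 1) (hq : toSite q ∈ meshVertices Ω 1),
    (meshVertexGraph Ω 1).Reachable ⟨toSite r, hr⟩ ⟨toSite q, hq⟩

/-- One adjacency step of reachability in a good domain. [folklore] -/
theorem GoodDomain.reach_step (hG : GoodDomain Ω E) {r p q : ZZ} (h : ReachIn Ω r p) (hpq : EAdj E p q) :
    ReachIn Ω r q := by
  obtain ⟨hr, hp, hreach⟩ := h
  have hq : toSite q ∈ meshVertices Ω 1 := (hG.memV _).2 (by simpa using hpq.snd_mem_verts)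
  refine ⟨hr, hq, hreach.trans (SimpleGraph.Adj.reachable ?_)⟩
  rw [SimpleGraph.induce_adj, hG.adjG]
  simpa using hpq

/-- Every vertex listed by `dfs` from `r` is reachable from `r` (good domain). [folklore] -/
theorem GoodDomain.dfs_reach (hG : GoodDomain Ω E) (r : ZZ) :
    ∀ (fuel : ℕ) (path : List ZZ), (∀ q ∈ path, ReachIn Ω r q) →
      ∀ l ∈ dfs E fuel path, ∀ q ∈ l, ReachIn Ω r q := by
  intro fuel
  induction fuel with
  | zero =>
    intro path hpath l hl q hq
    simp only [dfs, List.mem_singleton] at hl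
    subst hl
    exact hpath q hq
  | succ f ih =>
    intro path hpath l hl q hq
    cases path with
    | nil => simp [dfs] at hl
    | cons cur rest =>
      simp only [dfs, List.mem_cons, List.mem_flatMap, List.mem_filter] at hl
      rcases hl with rfl | ⟨q', ⟨hq', -⟩, hl⟩
      · exact hpath q hq
      · refine ih (q' :: cur :: rest) ?_ l hl q hq
        intro q'' hq''
        rcases List.mem_cons.1 hq'' with rfl | h
        · exact hG.reach_step (hpath cur (by simp)) (mem_nbrs_iff.1 hq')
        · exact hpath q'' h

/-- The mesh-vertex graph of a good domain is preconnected. [folklore] -/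
theorem GoodDomain.preconnected (hG : GoodDomain Ω E) : (meshVertexGraph Ω 1).Preconnected := by
  obtain ⟨r, hr, fuel, hconn⟩ := hG.conn
  have hr' : toSite r ∈ meshVertices Ω 1 := (hG.memV _).2 (by simpa using hr)
  have hroot : ∀ q ∈ [r], ReachIn Ω r q := by
    intro q hq
    simp only [List.mem_singleton] at hq
    subst hq
    exact ⟨hr', hr', SimpleGraph.Reachable.refl _⟩
  have key : ∀ u : meshVertices Ω 1, (meshVertexGraph Ω 1).Reachable ⟨toSite r, hr'⟩ u := by
    rintro ⟨s, hs⟩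
    have hs' := (hG.memV s).1 hs
    obtain ⟨l, hl, hmem⟩ := hconn _ hs'
    obtain ⟨_, hq, hreach⟩ := hG.dfs_reach r fuel [r] hroot l hl _ hmem
    have : (⟨toSite (ofSite s), hq⟩ : meshVertices Ω 1) = ⟨s, hs⟩ := by
      apply Subtype.ext; simp
    rw [this] at hreach
    exact hreach
  intro u w
  exact (key u).symm.trans (key w)

/-- Discrete domain of a good domain = listed vertices. [folklore] -/
theorem GoodDomain.mem_meshDomain_iff (hG : GoodDomain Ω E) (s : Site 2) :
    s ∈ meshDomain Ω 1 ↔ ofSite s ∈ verts E := by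
  rw [meshDomain_eq_of_preconnected hG.preconnected, hG.memV]

/-- Discrete-domain graph of a good domain = listed edges. [folklore] -/
theorem GoodDomain.adj_iff (hG : GoodDomain Ω E) (s t : Site 2) :
    (discreteDomainGraph Ω 1).Adj s t ↔ EAdj E (ofSite s) (ofSite t) := by
  rw [discreteDomainGraph_adj_iff, hG.mem_meshDomain_iff, hG.mem_meshDomain_iff, hG.adjG]
  constructor
  · exact fun h => h.1
  · exact fun h => ⟨h, h.fst_mem_verts, h.snd_mem_verts⟩

/-- Discrete-domain graph of a good domain = listed edges (integer coordinates). [folklore] -/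
theorem GoodDomain.adj_toSite_iff (hG : GoodDomain Ω E) (p q : ZZ) :
    (discreteDomainGraph Ω 1).Adj (toSite p) (toSite q) ↔ EAdj E p q := by
  rw [hG.adj_iff, ofSite_toSite, ofSite_toSite]

/-- Adjacency from the edge list, discharged by `decide` (good domain). [folklore] -/
abbrev GoodDomain.A (hG : GoodDomain Ω E) (p q : ZZ) (h : EAdj E p q := by decide) :
    (discreteDomainGraph Ω 1).Adj (toSite p) (toSite q) :=
  (hG.adj_toSite_iff p q).2 h

/-- **Completeness** of the depth-first enumeration for SAWs of a good domain. [folklore] -/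
theorem GoodDomain.support_mem_dfs (hG : GoodDomain Ω E) {a z : Site 2}
    (γ : Literature.Probability.RandomPlanarGeometry.SAW.DomainSAW Ω 1 a z) (ha : ofSite a ∈ verts E) {fuel : ℕ}
    (hfuel : (verts E).length ≤ fuel) :
    (γ.walk.support.map ofSite).reverse ∈ dfs E fuel [ofSite a] := by
  have hadj : ∀ s t, (discreteDomainGraph Ω 1).Adj s t → EAdj E (ofSite s) (ofSite t) :=
    fun s t h => (hG.adj_iff s t).1 h
  have hnd : (γ.walk.support.map ofSite).Nodup :=
    (SimpleGraph.Walk.isPath_def _ |>.1 γ.isPath).map ofSite_injective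
  have hsub : γ.walk.support.map ofSite ⊆ verts E := by
    intro q hq
    obtain ⟨s, hs, rfl⟩ := List.mem_map.1 hq
    exact support_subset_verts _ hadj γ.walk ha s hs
  have hlen : γ.walk.length ≤ fuel := by
    have h1 := (List.subperm_of_subset hnd hsub).length_le
    rw [List.length_map, SimpleGraph.Walk.length_support] at h1
    omega
  have key := dfs_complete (E := E) _ hadj γ.walk fuel [] hlen hnd (by simp)
  have hsupp : γ.walk.support = a :: γ.walk.support.tail := (γ.walk.cons_tail_support).symm
  rw [show (γ.walk.support.map ofSite).reverse = (γ.walk.support.tail.map ofSite).reverse ++ [ofSite a]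
    from by conv_lhs => rw [hsupp]; simp only [List.map_cons, List.reverse_cons]]
  exact key

/-- The origin has its four neighbours in the discrete domain (good domain version). [folklore] -/
theorem GoodDomain.adj_four (hG : GoodDomain Ω E) (h0 : EAdj E (0, 0) (1, 0)) (h1 : EAdj E (0, 0) (0, 1))
    (h2 : EAdj E (0, 0) (-1, 0)) (h3 : EAdj E (0, 0) (0, -1)) :
    ∀ i : Fin 4, (discreteDomainGraph Ω 1).Adj (toSite (0, 0)) (toSite (0, 0) + dirZ2 i) := by
  intro i
  fin_cases i
  · simp only [Fin.zero_eta, Fin.isValue, toSite_zero_add_dirZ2_0]; exact hG.A _ _ h0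
  · simp only [Fin.mk_one, Fin.isValue, toSite_zero_add_dirZ2_1]; exact hG.A _ _ h1
  · simp only [Fin.reduceFinMk, toSite_zero_add_dirZ2_2]; exact hG.A _ _ h2
  · simp only [Fin.reduceFinMk, toSite_zero_add_dirZ2_3]; exact hG.A _ _ h3

/-! ### Compactness and star-shape of segment unions -/

/-- Unit segments are compact. [folklore] -/
theorem isCompact_seg (e : ZZ × ZZ) : IsCompact (seg e) := by
  rw [seg, segment_eq_image]
  exact isCompact_Icc.image (by fun_prop)

/-- `Ω_E` is compact. [folklore] -/
theorem isCompact_Omega (E : List (ZZ × ZZ)) : IsCompact (Omega E) := by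
  have : Omega E = ⋃ e ∈ {e | e ∈ E}, seg e := by
    ext z; simp [Omega]
  rw [this]
  exact (List.finite_toSet E).isCompact_biUnion fun e _ => isCompact_seg e

/-- `pt (0,0) = 0`. [folklore] -/
@[simp] theorem pt_zero : pt (0, 0) = 0 := by
  apply Complex.ext <;> simp [pt]

/-- A union of segments each having the origin as an endpoint is star-shaped about the origin. [folklore] -/
theorem starConvex_Omega (h : ∀ e ∈ E, e.1 = (0, 0) ∨ e.2 = (0, 0)) :
    StarConvex ℝ (pt (0, 0)) (Omega E) := by
  have : Omega E = ⋃ e ∈ {e | e ∈ E}, seg e := by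
    ext z; simp [Omega]
  rw [this]
  refine starConvex_iUnion fun e => starConvex_iUnion fun he => ?_
  rcases h e he with h1 | h2
  · rw [seg, h1]; exact (convex_segment _ _).starConvex (left_mem_segment _ _ _)
  · rw [seg, h2]; exact (convex_segment _ _).starConvex (right_mem_segment _ _ _)

/-! ### Closed lattice boxes with pendant edges -/

/-- The closed box `[m₁, m₂] × [n₁, n₂]`. [folklore] -/
def box (m₁ m₂ n₁ n₂ : ℤ) : Set ℂ :=
  ({z : ℂ | (m₁ : ℝ) ≤ z.re} ∩ {z : ℂ | z.re ≤ (m₂ : ℝ)}) ∩ ({z : ℂ | (n₁ : ℝ) ≤ z.im} ∩ {z : ℂ | z.im ≤ (n₂ : ℝ)})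

/-- Integer membership in the box. [folklore] -/
def InBox (m₁ m₂ n₁ n₂ : ℤ) (r : ZZ) : Prop := m₁ ≤ r.1 ∧ r.1 ≤ m₂ ∧ n₁ ≤ r.2 ∧ r.2 ≤ n₂

/-- Decidability instance (kernel computation by `decide`). [folklore] -/
instance (m₁ m₂ n₁ n₂ : ℤ) : DecidablePred (InBox m₁ m₂ n₁ n₂) := fun r => by unfold InBox; infer_instance

variable {m₁ m₂ n₁ n₂ : ℤ}

/-- Membership in the box, unfolded. [folklore] -/
theorem mem_box_iff (z : ℂ) : z ∈ box m₁ m₂ n₁ n₂ ↔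
    (m₁ : ℝ) ≤ z.re ∧ z.re ≤ m₂ ∧ (n₁ : ℝ) ≤ z.im ∧ z.im ≤ n₂ := by
  simp only [box, Set.mem_inter_iff, Set.mem_setOf_eq, and_assoc]

/-- The box is convex. [folklore] -/
theorem convex_box : Convex ℝ (box m₁ m₂ n₁ n₂) :=
  ((convex_halfSpace_re_ge _).inter (convex_halfSpace_re_le _)).inter
    ((convex_halfSpace_im_ge _).inter (convex_halfSpace_im_le _))

/-- The box is closed. [folklore] -/
theorem isClosed_box : IsClosed (box m₁ m₂ n₁ n₂) :=
  ((isClosed_le continuous_const Complex.continuous_re).inter (isClosed_le Complex.continuous_re continuous_const)).inter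
    ((isClosed_le continuous_const Complex.continuous_im).inter (isClosed_le Complex.continuous_im continuous_const))

/-- The box is compact. [folklore] -/
theorem isCompact_box : IsCompact (box m₁ m₂ n₁ n₂) := by
  refine Metric.isCompact_of_isClosed_isBounded isClosed_box ?_
  refine (Metric.isBounded_iff_subset_closedBall 0).2 ⟨|(m₁ : ℝ)| + |(m₂ : ℝ)| + |(n₁ : ℝ)| + |(n₂ : ℝ)|, fun z hz => ?_⟩
  obtain ⟨h1, h2, h3, h4⟩ := (mem_box_iff z).1 hz
  rw [Metric.mem_closedBall, dist_zero_right]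
  refine (Complex.norm_le_abs_re_add_abs_im z).trans ?_
  have hre : |z.re| ≤ |(m₁ : ℝ)| + |(m₂ : ℝ)| := by
    rcases le_or_gt 0 z.re with h | h
    · rw [abs_of_nonneg h]; linarith [le_abs_self (m₂ : ℝ), abs_nonneg (m₁ : ℝ)]
    · rw [abs_of_neg h]; linarith [neg_abs_le (m₁ : ℝ), abs_nonneg (m₂ : ℝ)]
  have him : |z.im| ≤ |(n₁ : ℝ)| + |(n₂ : ℝ)| := by
    rcases le_or_gt 0 z.im with h | h
    · rw [abs_of_nonneg h]; linarith [le_abs_self (n₂ : ℝ), abs_nonneg (n₁ : ℝ)]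
    · rw [abs_of_neg h]; linarith [neg_abs_le (n₁ : ℝ), abs_nonneg (n₂ : ℝ)]
  linarith

/-- Integer points of the box. [folklore] -/
theorem pt_mem_box_iff (r : ZZ) : pt r ∈ box m₁ m₂ n₁ n₂ ↔ InBox m₁ m₂ n₁ n₂ r := by
  rw [mem_box_iff]
  simp only [pt_re, pt_im, Int.cast_le, InBox]

/-- A unit-edge midpoint lies in the box iff both endpoints do (integer corners). [folklore] -/
theorem midpt_mem_box_iff {e : ZZ × ZZ} (he : IsUnitDart e) :
    midpt e ∈ box m₁ m₂ n₁ n₂ ↔ InBox m₁ m₂ n₁ n₂ e.1 ∧ InBox m₁ m₂ n₁ n₂ e.2 := by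
  rw [mem_box_iff]
  obtain ⟨⟨p1, p2⟩, ⟨q1, q2⟩⟩ := e
  simp only [IsUnitDart, Prod.mk.injEq] at he
  have hre : (midpt ((p1, p2), (q1, q2))).re = ((p1 : ℝ) + q1) / 2 := by simp [midpt, pt]
  have him : (midpt ((p1, p2), (q1, q2))).im = ((p2 : ℝ) + q2) / 2 := by simp [midpt, pt]
  rw [hre, him]
  simp only [InBox]
  rcases he with ⟨hq1, hq2⟩ | ⟨hq1, hq2⟩
  · -- horizontal dart: `q1 = p1 + 1`, `q2 = p2`
    rw [hq1, hq2]; push_cast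
    constructor
    · rintro ⟨h1, h2, h3, h4⟩
      have h1' : ((m₁ : ℤ) : ℝ) < ((p1 + 1 : ℤ) : ℝ) := by push_cast; linarith
      have h2' : ((p1 : ℤ) : ℝ) < ((m₂ : ℤ) : ℝ) := by linarith
      have h3' : ((n₁ : ℤ) : ℝ) ≤ ((p2 : ℤ) : ℝ) := by linarith
      have h4' : ((p2 : ℤ) : ℝ) ≤ ((n₂ : ℤ) : ℝ) := by linarith
      have := Int.cast_lt.1 h1'; have := Int.cast_lt.1 h2'; have := Int.cast_le.1 h3'
      have := Int.cast_le.1 h4'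
      omega
    · rintro ⟨⟨h1, -, h3, h4⟩, ⟨-, h6, -, -⟩⟩
      have h1' : ((m₁ : ℤ) : ℝ) ≤ p1 := Int.cast_le.2 h1
      have h6' : ((p1 + 1 : ℤ) : ℝ) ≤ m₂ := Int.cast_le.2 h6
      have h3' : ((n₁ : ℤ) : ℝ) ≤ p2 := Int.cast_le.2 h3
      have h4' : ((p2 : ℤ) : ℝ) ≤ n₂ := Int.cast_le.2 h4
      push_cast at h6'
      exact ⟨by linarith, by linarith, by linarith, by linarith⟩
  · -- vertical dart: `q1 = p1`, `q2 = p2 + 1`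
    rw [hq1, hq2]; push_cast
    constructor
    · rintro ⟨h1, h2, h3, h4⟩
      have h1' : ((m₁ : ℤ) : ℝ) ≤ ((p1 : ℤ) : ℝ) := by linarith
      have h2' : ((p1 : ℤ) : ℝ) ≤ ((m₂ : ℤ) : ℝ) := by linarith
      have h3' : ((n₁ : ℤ) : ℝ) < ((p2 + 1 : ℤ) : ℝ) := by push_cast; linarith
      have h4' : ((p2 : ℤ) : ℝ) < ((n₂ : ℤ) : ℝ) := by linarith
      have := Int.cast_le.1 h1'; have := Int.cast_le.1 h2'; have := Int.cast_lt.1 h3'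
      have := Int.cast_lt.1 h4'
      omega
    · rintro ⟨⟨h1, h2, h3, -⟩, ⟨-, -, -, h8⟩⟩
      have h1' : ((m₁ : ℤ) : ℝ) ≤ p1 := Int.cast_le.2 h1
      have h2' : ((p1 : ℤ) : ℝ) ≤ m₂ := Int.cast_le.2 h2
      have h3' : ((n₁ : ℤ) : ℝ) ≤ p2 := Int.cast_le.2 h3
      have h8' : ((p2 + 1 : ℤ) : ℝ) ≤ n₂ := Int.cast_le.2 h8
      push_cast at h8'
      exact ⟨by linarith, by linarith, by linarith, by linarith⟩

/-- **Box with pendant edges**: the closed box together with the unit segments of `P`. [folklore] -/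
def BoxPend (m₁ m₂ n₁ n₂ : ℤ) (P : List (ZZ × ZZ)) : Set ℂ := box m₁ m₂ n₁ n₂ ∪ Omega P

variable {P : List (ZZ × ZZ)}

/-- `BoxPend` is compact. [folklore] -/
theorem isCompact_BoxPend : IsCompact (BoxPend m₁ m₂ n₁ n₂ P) :=
  isCompact_box.union (isCompact_Omega P)

/-- `BoxPend` is closed. [folklore] -/
theorem closure_BoxPend : closure (BoxPend m₁ m₂ n₁ n₂ P) = BoxPend m₁ m₂ n₁ n₂ P :=
  isCompact_BoxPend.isClosed.closure_eq

/-- `BoxPend` is star-shaped about the origin when the box contains it and every pendant edge ends at it. [folklore] -/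
theorem starConvex_BoxPend (h0 : InBox m₁ m₂ n₁ n₂ (0, 0)) (hP : ∀ e ∈ P, e.1 = (0, 0) ∨ e.2 = (0, 0)) :
    StarConvex ℝ (pt (0, 0)) (BoxPend m₁ m₂ n₁ n₂ P) :=
  (convex_box.starConvex ((pt_mem_box_iff _).2 h0)).union (starConvex_Omega hP)

/-- A unit segment lies in `BoxPend` iff both endpoints are in the box or it is a pendant edge. [folklore] -/
theorem seg_subset_BoxPend_iff (hP : ∀ e ∈ P, IsUnitDart e) {e : ZZ × ZZ} (he : IsUnitDart e) :
    seg e ⊆ BoxPend m₁ m₂ n₁ n₂ P ↔ (InBox m₁ m₂ n₁ n₂ e.1 ∧ InBox m₁ m₂ n₁ n₂ e.2) ∨ e ∈ P := by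
  constructor
  · intro h
    rcases h (midpt_mem_seg e) with hb | hO
    · exact Or.inl ((midpt_mem_box_iff he).1 hb)
    · exact Or.inr ((midpt_mem_Omega_iff hP he).1 hO)
  · rintro (⟨h1, h2⟩ | h)
    · exact (convex_box.segment_subset ((pt_mem_box_iff _).2 h1) ((pt_mem_box_iff _).2 h2)).trans
        Set.subset_union_left
    · exact fun z hz => Or.inr ⟨e, h, hz⟩

/-- Integer points of `BoxPend`. [folklore] -/
theorem pt_mem_BoxPend_iff (hP : ∀ e ∈ P, IsUnitDart e) (r : ZZ) :
    pt r ∈ BoxPend m₁ m₂ n₁ n₂ P ↔ InBox m₁ m₂ n₁ n₂ r ∨ r ∈ verts P := by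
  rw [BoxPend, Set.mem_union, pt_mem_box_iff, pt_mem_Omega_iff hP]

/-- **A box with pendant edges is a good domain** for the edge list `E`, given the (finite,
decidable) bookkeeping identities `hE`, `hV` and a connectivity certificate. [folklore] -/
theorem goodDomain_BoxPend {E : List (ZZ × ZZ)} (hP : ∀ e ∈ P, IsUnitDart e)
    (hE : ∀ e : ZZ × ZZ, e ∈ E ↔ IsUnitDart e ∧ ((InBox m₁ m₂ n₁ n₂ e.1 ∧ InBox m₁ m₂ n₁ n₂ e.2) ∨ e ∈ P))
    (hV : ∀ r : ZZ, r ∈ verts E ↔ InBox m₁ m₂ n₁ n₂ r ∨ r ∈ verts P)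
    (hconn : ∃ r ∈ verts E, ∃ fuel : ℕ, ∀ p ∈ verts E, ∃ l ∈ dfs E fuel [r], p ∈ l) :
    GoodDomain (BoxPend m₁ m₂ n₁ n₂ P) E := by
  refine ⟨fun e he => ((hE e).1 he).1, fun s => ?_, fun s t => ?_, hconn⟩
  · rw [Literature.Probability.LatticeModels.mem_meshVertices_iff, meshPoint_one, pt_mem_BoxPend_iff hP, hV]
  · rw [meshGraph_adj_iff, closure_BoxPend, zdGraph_adj_iff]
    constructor
    · rintro ⟨⟨i, h | h⟩, hseg⟩
      · left
        have hu := isUnitDart_of_eq_add_single s i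
        rw [← h] at hu
        rw [meshPoint_one, meshPoint_one] at hseg
        exact (hE _).2 ⟨hu, (seg_subset_BoxPend_iff hP hu).1 hseg⟩
      · right
        have hu := isUnitDart_of_eq_add_single t i
        rw [← h] at hu
        rw [meshPoint_one, meshPoint_one, segment_symm] at hseg
        exact (hE _).2 ⟨hu, (seg_subset_BoxPend_iff hP hu).1 hseg⟩
    · intro h
      have key : ∀ {s t : Site 2}, (ofSite s, ofSite t) ∈ E →
          (∃ i : Fin 2, t = s + Pi.single i 1 ∨ s = t + Pi.single i 1) ∧
            segment ℝ (meshPoint 1 s) (meshPoint 1 t) ⊆ BoxPend m₁ m₂ n₁ n₂ P := by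
        intro s t hst
        obtain ⟨hu, hin⟩ := (hE _).1 hst
        refine ⟨?_, ?_⟩
        · rcases hu with hu | hu
          · refine ⟨0, Or.inl ?_⟩
            simp only [Prod.mk.injEq, ofSite] at hu
            funext j; fin_cases j <;> simp [hu]
          · refine ⟨1, Or.inl ?_⟩
            simp only [Prod.mk.injEq, ofSite] at hu
            funext j; fin_cases j <;> simp [hu]
        · rw [meshPoint_one, meshPoint_one]
          exact (seg_subset_BoxPend_iff hP hu).2 hin
      rcases h with h | h
      · exact key h
      · obtain ⟨⟨i, hi⟩, hseg⟩ := key h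
        exact ⟨⟨i, hi.symm⟩, by rwa [segment_symm]⟩

/-! ### The three star-shaped domains `Q`, `Q̄`, `O₂` -/

/-- Pendant edges of `Q`: `v–E` and `S–v`. [folklore] -/
def PQ : List (ZZ × ZZ) := [((0,0),(1,0)), ((0,-1),(0,0))]
/-- Edge list of `Q` = unit square `[-1,0]×[0,1]` plus the pendants. [folklore] -/
def QE : List (ZZ × ZZ) :=
  [((0,0),(1,0)), ((0,0),(0,1)), ((-1,0),(0,0)), ((0,-1),(0,0)), ((-1,1),(0,1)), ((-1,0),(-1,1))]
/-- The plane set `Ω_Q`. [folklore] -/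
def OmQ : Set ℂ := BoxPend (-1) 0 0 1 PQ

/-- Pendant edges of `Q̄`: `v–E` and `v–N`. [folklore] -/
def PQb : List (ZZ × ZZ) := [((0,0),(1,0)), ((0,0),(0,1))]
/-- Edge list of `Q̄` = unit square `[-1,0]×[-1,0]` plus the pendants. [folklore] -/
def QbE : List (ZZ × ZZ) :=
  [((0,0),(1,0)), ((0,0),(0,1)), ((-1,0),(0,0)), ((0,-1),(0,0)), ((-1,-1),(0,-1)), ((-1,-1),(-1,0))]
/-- The plane set `Ω_Q̄`. [folklore] -/
def OmQb : Set ℂ := BoxPend (-1) 0 (-1) 0 PQb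

/-- Pendant edge of `O₂`: `v–E`. [folklore] -/
def PO2 : List (ZZ × ZZ) := [((0,0),(1,0))]
/-- Edge list of `O₂` = rectangle `[-1,0]×[-1,1]` plus the pendant. [folklore] -/
def O2E : List (ZZ × ZZ) :=
  [((0,0),(1,0)), ((0,0),(0,1)), ((-1,0),(0,0)), ((0,-1),(0,0)), ((-1,1),(0,1)), ((-1,0),(-1,1)),
   ((-1,-1),(0,-1)), ((-1,-1),(-1,0))]
/-- The plane set `Ω_O₂`. [folklore] -/
def OmO2 : Set ℂ := BoxPend (-1) 0 (-1) 1 PO2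

/-- `Ω_Q` realises the edge list `QE`. [folklore] -/
theorem goodQ : GoodDomain OmQ QE := by
  refine goodDomain_BoxPend (by decide) (fun e => ?_) (fun r => ?_) ⟨(1, 0), by decide, 12, by decide⟩
  · obtain ⟨⟨a, b⟩, ⟨c, d⟩⟩ := e
    simp only [QE, PQ, InBox, IsUnitDart, List.mem_cons, Prod.mk.injEq, List.not_mem_nil, or_false]
    omega
  · obtain ⟨a, b⟩ := r
    simp only [mem_verts_iff, QE, PQ, InBox, List.mem_cons, Prod.mk.injEq, List.not_mem_nil, or_false,
      exists_eq_or_imp, exists_eq_left]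
    omega

/-- `Ω_Q̄` realises the edge list `QbE`. [folklore] -/
theorem goodQb : GoodDomain OmQb QbE := by
  refine goodDomain_BoxPend (by decide) (fun e => ?_) (fun r => ?_) ⟨(1, 0), by decide, 12, by decide⟩
  · obtain ⟨⟨a, b⟩, ⟨c, d⟩⟩ := e
    simp only [QbE, PQb, InBox, IsUnitDart, List.mem_cons, Prod.mk.injEq, List.not_mem_nil, or_false]
    omega
  · obtain ⟨a, b⟩ := r
    simp only [mem_verts_iff, QbE, PQb, InBox, List.mem_cons, Prod.mk.injEq, List.not_mem_nil, or_false,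
      exists_eq_or_imp, exists_eq_left]
    omega

/-- `Ω_O₂` realises the edge list `O2E`. [folklore] -/
theorem goodO2 : GoodDomain OmO2 O2E := by
  refine goodDomain_BoxPend (by decide) (fun e => ?_) (fun r => ?_) ⟨(1, 0), by decide, 16, by decide⟩
  · obtain ⟨⟨a, b⟩, ⟨c, d⟩⟩ := e
    simp only [O2E, PO2, InBox, IsUnitDart, List.mem_cons, Prod.mk.injEq, List.not_mem_nil, or_false]
    omega
  · obtain ⟨a, b⟩ := r
    simp only [mem_verts_iff, O2E, PO2, InBox, List.mem_cons, Prod.mk.injEq, List.not_mem_nil, or_false,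
      exists_eq_or_imp, exists_eq_left]
    omega

/-- `Ω_Q` is compact and star-shaped about the stencil's vertex. [folklore] -/
theorem isCompact_OmQ : IsCompact OmQ := isCompact_BoxPend
/-- `Ω_Q` is compact and star-shaped about the stencil's vertex. [folklore] -/
theorem starConvex_OmQ : StarConvex ℝ (meshPoint 1 (toSite (0, 0))) OmQ := by
  rw [meshPoint_one_toSite]; exact starConvex_BoxPend (by decide) (by decide)
/-- `Ω_Q̄` is compact and star-shaped about the stencil's vertex. [folklore] -/
theorem isCompact_OmQb : IsCompact OmQb := isCompact_BoxPend
/-- `Ω_Q̄` is compact and star-shaped about the stencil's vertex. [folklore] -/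
theorem starConvex_OmQb : StarConvex ℝ (meshPoint 1 (toSite (0, 0))) OmQb := by
  rw [meshPoint_one_toSite]; exact starConvex_BoxPend (by decide) (by decide)
/-- `Ω_O₂` is compact and star-shaped about the stencil's vertex. [folklore] -/
theorem isCompact_OmO2 : IsCompact OmO2 := isCompact_BoxPend
/-- `Ω_O₂` is compact and star-shaped about the stencil's vertex. [folklore] -/
theorem starConvex_OmO2 : StarConvex ℝ (meshPoint 1 (toSite (0, 0))) OmO2 := by
  rw [meshPoint_one_toSite]; exact starConvex_BoxPend (by decide) (by decide)
/-- `Ω_P` (the plus) is compact and star-shaped about the stencil's vertex. [folklore] -/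
theorem isCompact_OmP : IsCompact (Omega PE) := isCompact_Omega PE
/-- `Ω_P` (the plus) is compact and star-shaped about the stencil's vertex. [folklore] -/
theorem starConvex_OmP : StarConvex ℝ (meshPoint 1 (toSite (0, 0))) (Omega PE) := by
  rw [meshPoint_one_toSite]; exact starConvex_Omega (by decide)


/-! #### Instance `Q` (star-shaped), root `(1, 0)` -/

/-- explicit self-avoiding walk `(1,0) → (0,0)` [folklore] -/
def w_Q_1_0_0_0 : Literature.Probability.RandomPlanarGeometry.SAW.DomainSAW OmQ 1 (toSite (1, 0)) (toSite (0, 0)) :=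
  ⟨SimpleGraph.Walk.cons (goodQ.A (1, 0) (0, 0)) <|
  SimpleGraph.Walk.nil, (SimpleGraph.Walk.isPath_def _).2 (by decide)⟩

/-- Enumeration certificate: the self-avoiding walks between these endpoints are exactly the listed ones (completeness of `dfs` + `decide`). [folklore] -/
theorem enum_Q_1_0_0 : ∀ γ : Literature.Probability.RandomPlanarGeometry.SAW.DomainSAW OmQ 1 (toSite (1, 0)) (toSite (0, 0)),
    γ = w_Q_1_0_0_0 := by
  intro γ
  have hmem := goodQ.support_mem_dfs γ (by decide) (fuel := 12) (by decide)
  have hhead := head?_reverse_map_support γ.walk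
  have hall : ∀ l ∈ dfs QE 12 [ofSite (toSite (1, 0))], l.head? = some (ofSite (toSite (0, 0))) →
      l = [(0, 0), (1, 0)] := by decide
  have h := hall _ hmem hhead
  apply DomainSAW_eq_of_support; rw [support_eq_of_reverse_map γ.walk h]; decide

/-- the trivial walk at the root [folklore] -/
def nil_Q_1_0 : Literature.Probability.RandomPlanarGeometry.SAW.DomainSAW OmQ 1 (toSite (1, 0)) (toSite (1, 0)) := Literature.Probability.RandomPlanarGeometry.SAW.DomainSAW.nil _

/-- Enumeration certificate: the self-avoiding walks between these endpoints are exactly the listed ones. [folklore] -/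
theorem enum_Q_1_0_1 : ∀ γ : Literature.Probability.RandomPlanarGeometry.SAW.DomainSAW OmQ 1 (toSite (1, 0)) (toSite (1, 0)), γ = nil_Q_1_0 :=
  Literature.Probability.RandomPlanarGeometry.SAW.DomainSAW.eq_nil_of_self

/-- explicit self-avoiding walk `(1,0) → (0,0) → (0,1)` [folklore] -/
def w_Q_1_0_2_0 : Literature.Probability.RandomPlanarGeometry.SAW.DomainSAW OmQ 1 (toSite (1, 0)) (toSite (0, 1)) :=
  ⟨SimpleGraph.Walk.cons (goodQ.A (1, 0) (0, 0)) <|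
  SimpleGraph.Walk.cons (goodQ.A (0, 0) (0, 1)) <|
  SimpleGraph.Walk.nil, (SimpleGraph.Walk.isPath_def _).2 (by decide)⟩

/-- explicit self-avoiding walk `(1,0) → (0,0) → (-1,0) → (-1,1) → (0,1)` [folklore] -/
def w_Q_1_0_2_1 : Literature.Probability.RandomPlanarGeometry.SAW.DomainSAW OmQ 1 (toSite (1, 0)) (toSite (0, 1)) :=
  ⟨SimpleGraph.Walk.cons (goodQ.A (1, 0) (0, 0)) <|
  SimpleGraph.Walk.cons (goodQ.A (0, 0) (-1, 0)) <|
  SimpleGraph.Walk.cons (goodQ.A (-1, 0) (-1, 1)) <|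
  SimpleGraph.Walk.cons (goodQ.A (-1, 1) (0, 1)) <|
  SimpleGraph.Walk.nil, (SimpleGraph.Walk.isPath_def _).2 (by decide)⟩

/-- Enumeration certificate: the self-avoiding walks between these endpoints are exactly the listed ones (completeness of `dfs` + `decide`). [folklore] -/
theorem enum_Q_1_0_2 : ∀ γ : Literature.Probability.RandomPlanarGeometry.SAW.DomainSAW OmQ 1 (toSite (1, 0)) (toSite (0, 1)),
    γ = w_Q_1_0_2_0 ∨ γ = w_Q_1_0_2_1 := by
  intro γ
  have hmem := goodQ.support_mem_dfs γ (by decide) (fuel := 12) (by decide)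
  have hhead := head?_reverse_map_support γ.walk
  have hall : ∀ l ∈ dfs QE 12 [ofSite (toSite (1, 0))], l.head? = some (ofSite (toSite (0, 1))) →
      l = [(0, 1), (0, 0), (1, 0)] ∨ l = [(0, 1), (-1, 1), (-1, 0), (0, 0), (1, 0)] := by decide
  rcases hall _ hmem hhead with h | h
  · left; apply DomainSAW_eq_of_support; rw [support_eq_of_reverse_map γ.walk h]; decide
  · right; apply DomainSAW_eq_of_support; rw [support_eq_of_reverse_map γ.walk h]; decide

/-- explicit self-avoiding walk `(1,0) → (0,0) → (0,1) → (-1,1) → (-1,0)` [folklore] -/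
def w_Q_1_0_3_0 : Literature.Probability.RandomPlanarGeometry.SAW.DomainSAW OmQ 1 (toSite (1, 0)) (toSite (-1, 0)) :=
  ⟨SimpleGraph.Walk.cons (goodQ.A (1, 0) (0, 0)) <|
  SimpleGraph.Walk.cons (goodQ.A (0, 0) (0, 1)) <|
  SimpleGraph.Walk.cons (goodQ.A (0, 1) (-1, 1)) <|
  SimpleGraph.Walk.cons (goodQ.A (-1, 1) (-1, 0)) <|
  SimpleGraph.Walk.nil, (SimpleGraph.Walk.isPath_def _).2 (by decide)⟩

/-- explicit self-avoiding walk `(1,0) → (0,0) → (-1,0)` [folklore] -/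
def w_Q_1_0_3_1 : Literature.Probability.RandomPlanarGeometry.SAW.DomainSAW OmQ 1 (toSite (1, 0)) (toSite (-1, 0)) :=
  ⟨SimpleGraph.Walk.cons (goodQ.A (1, 0) (0, 0)) <|
  SimpleGraph.Walk.cons (goodQ.A (0, 0) (-1, 0)) <|
  SimpleGraph.Walk.nil, (SimpleGraph.Walk.isPath_def _).2 (by decide)⟩

/-- Enumeration certificate: the self-avoiding walks between these endpoints are exactly the listed ones (completeness of `dfs` + `decide`). [folklore] -/
theorem enum_Q_1_0_3 : ∀ γ : Literature.Probability.RandomPlanarGeometry.SAW.DomainSAW OmQ 1 (toSite (1, 0)) (toSite (-1, 0)),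
    γ = w_Q_1_0_3_0 ∨ γ = w_Q_1_0_3_1 := by
  intro γ
  have hmem := goodQ.support_mem_dfs γ (by decide) (fuel := 12) (by decide)
  have hhead := head?_reverse_map_support γ.walk
  have hall : ∀ l ∈ dfs QE 12 [ofSite (toSite (1, 0))], l.head? = some (ofSite (toSite (-1, 0))) →
      l = [(-1, 0), (-1, 1), (0, 1), (0, 0), (1, 0)] ∨ l = [(-1, 0), (0, 0), (1, 0)] := by decide
  rcases hall _ hmem hhead with h | h
  · left; apply DomainSAW_eq_of_support; rw [support_eq_of_reverse_map γ.walk h]; decide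
  · right; apply DomainSAW_eq_of_support; rw [support_eq_of_reverse_map γ.walk h]; decide

/-- explicit self-avoiding walk `(1,0) → (0,0) → (0,-1)` [folklore] -/
def w_Q_1_0_4_0 : Literature.Probability.RandomPlanarGeometry.SAW.DomainSAW OmQ 1 (toSite (1, 0)) (toSite (0, -1)) :=
  ⟨SimpleGraph.Walk.cons (goodQ.A (1, 0) (0, 0)) <|
  SimpleGraph.Walk.cons (goodQ.A (0, 0) (0, -1)) <|
  SimpleGraph.Walk.nil, (SimpleGraph.Walk.isPath_def _).2 (by decide)⟩

/-- Enumeration certificate: the self-avoiding walks between these endpoints are exactly the listed ones (completeness of `dfs` + `decide`). [folklore] -/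
theorem enum_Q_1_0_4 : ∀ γ : Literature.Probability.RandomPlanarGeometry.SAW.DomainSAW OmQ 1 (toSite (1, 0)) (toSite (0, -1)),
    γ = w_Q_1_0_4_0 := by
  intro γ
  have hmem := goodQ.support_mem_dfs γ (by decide) (fuel := 12) (by decide)
  have hhead := head?_reverse_map_support γ.walk
  have hall : ∀ l ∈ dfs QE 12 [ofSite (toSite (1, 0))], l.head? = some (ofSite (toSite (0, -1))) →
      l = [(0, -1), (0, 0), (1, 0)] := by decide
  have h := hall _ hmem hhead
  apply DomainSAW_eq_of_support; rw [support_eq_of_reverse_map γ.walk h]; decide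

/-- Value of one half-edge term of the mid-edge observable on the explicit domain (from the enumeration certificate and the integer winding count). [folklore] -/
theorem hET_Q_1_0_E_out (x σ : ℝ) :
    Literature.Probability.RandomPlanarGeometry.SAW.halfEdgeTerm OmQ 1 (toSite (1, 0)) x σ (toSite (0, 0)) (toSite (1, 0)) = 0 := by
  refine halfEdgeTerm_eq_zero x σ (toSite (1, 0)) fun γ => ?_
  rw [enum_Q_1_0_0 γ]; decide

/-- Value of one half-edge term of the mid-edge observable on the explicit domain (from the enumeration certificate and the integer winding count). [folklore] -/
theorem hET_Q_1_0_E_in (x σ : ℝ) :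
    Literature.Probability.RandomPlanarGeometry.SAW.halfEdgeTerm OmQ 1 (toSite (1, 0)) x σ (toSite (1, 0)) (toSite (0, 0)) =
      (x : ℂ) := by
  rw [halfEdgeTerm_eq_single x σ (toSite (0, 0)) nil_Q_1_0 (fun γ hγ => absurd (enum_Q_1_0_1 γ) hγ)]
  rw [if_neg (by decide), winding_support_medial nil_Q_1_0.walk (toSite (0, 0)) (by decide),
    show quarterTurns (List.map ofSite nil_Q_1_0.walk.support ++ [ofSite (toSite (0, 0))]) = 0 from by decide,
    show Literature.Probability.RandomPlanarGeometry.SAW.DomainSAW.length nil_Q_1_0 = 0 from by decide, cexp_quarter_0 σ]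
  ring

/-- Value of one half-edge term of the mid-edge observable on the explicit domain (from the enumeration certificate and the integer winding count). [folklore] -/
theorem hET_Q_1_0_N_out (x σ : ℝ) :
    Literature.Probability.RandomPlanarGeometry.SAW.halfEdgeTerm OmQ 1 (toSite (1, 0)) x σ (toSite (0, 0)) (toSite (0, 1)) =
      (x : ℂ) ^ 2 * (tOf σ)⁻¹ := by
  rw [halfEdgeTerm_eq_single x σ (toSite (0, 1)) w_Q_1_0_0_0 (fun γ hγ => absurd (enum_Q_1_0_0 γ) hγ)]
  rw [if_neg (by decide), winding_support_medial w_Q_1_0_0_0.walk (toSite (0, 1)) (by decide),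
    show quarterTurns (List.map ofSite w_Q_1_0_0_0.walk.support ++ [ofSite (toSite (0, 1))]) = -1 from by decide,
    show Literature.Probability.RandomPlanarGeometry.SAW.DomainSAW.length w_Q_1_0_0_0 = 1 from by decide, cexp_quarter_m1 σ]
  ring

/-- Value of one half-edge term of the mid-edge observable on the explicit domain (from the enumeration certificate and the integer winding count). [folklore] -/
theorem hET_Q_1_0_N_in (x σ : ℝ) :
    Literature.Probability.RandomPlanarGeometry.SAW.halfEdgeTerm OmQ 1 (toSite (1, 0)) x σ (toSite (0, 1)) (toSite (0, 0)) =
      (x : ℂ) ^ 5 * (tOf σ)⁻¹ ^ 3 := by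
  rw [halfEdgeTerm_eq_single x σ (toSite (0, 0)) w_Q_1_0_2_1 (fun γ hγ => by
    rcases enum_Q_1_0_2 γ with rfl | rfl
    · decide
    · exact absurd rfl hγ
    )]
  rw [if_neg (by decide), winding_support_medial w_Q_1_0_2_1.walk (toSite (0, 0)) (by decide),
    show quarterTurns (List.map ofSite w_Q_1_0_2_1.walk.support ++ [ofSite (toSite (0, 0))]) = -3 from by decide,
    show Literature.Probability.RandomPlanarGeometry.SAW.DomainSAW.length w_Q_1_0_2_1 = 4 from by decide, cexp_quarter_m3 σ]
  ring

/-- Value of one half-edge term of the mid-edge observable on the explicit domain (from the enumeration certificate and the integer winding count). [folklore] -/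
theorem hET_Q_1_0_W_out (x σ : ℝ) :
    Literature.Probability.RandomPlanarGeometry.SAW.halfEdgeTerm OmQ 1 (toSite (1, 0)) x σ (toSite (0, 0)) (toSite (-1, 0)) =
      (x : ℂ) ^ 2 := by
  rw [halfEdgeTerm_eq_single x σ (toSite (-1, 0)) w_Q_1_0_0_0 (fun γ hγ => absurd (enum_Q_1_0_0 γ) hγ)]
  rw [if_neg (by decide), winding_support_medial w_Q_1_0_0_0.walk (toSite (-1, 0)) (by decide),
    show quarterTurns (List.map ofSite w_Q_1_0_0_0.walk.support ++ [ofSite (toSite (-1, 0))]) = 0 from by decide,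
    show Literature.Probability.RandomPlanarGeometry.SAW.DomainSAW.length w_Q_1_0_0_0 = 1 from by decide, cexp_quarter_0 σ]
  ring

/-- Value of one half-edge term of the mid-edge observable on the explicit domain (from the enumeration certificate and the integer winding count). [folklore] -/
theorem hET_Q_1_0_W_in (x σ : ℝ) :
    Literature.Probability.RandomPlanarGeometry.SAW.halfEdgeTerm OmQ 1 (toSite (1, 0)) x σ (toSite (-1, 0)) (toSite (0, 0)) =
      (x : ℂ) ^ 5 * tOf σ ^ 2 := by
  rw [halfEdgeTerm_eq_single x σ (toSite (0, 0)) w_Q_1_0_3_0 (fun γ hγ => by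
    rcases enum_Q_1_0_3 γ with rfl | rfl
    · exact absurd rfl hγ
    · decide
    )]
  rw [if_neg (by decide), winding_support_medial w_Q_1_0_3_0.walk (toSite (0, 0)) (by decide),
    show quarterTurns (List.map ofSite w_Q_1_0_3_0.walk.support ++ [ofSite (toSite (0, 0))]) = 2 from by decide,
    show Literature.Probability.RandomPlanarGeometry.SAW.DomainSAW.length w_Q_1_0_3_0 = 4 from by decide, cexp_quarter_2 σ]
  ring

/-- Value of one half-edge term of the mid-edge observable on the explicit domain (from the enumeration certificate and the integer winding count). [folklore] -/
theorem hET_Q_1_0_S_out (x σ : ℝ) :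
    Literature.Probability.RandomPlanarGeometry.SAW.halfEdgeTerm OmQ 1 (toSite (1, 0)) x σ (toSite (0, 0)) (toSite (0, -1)) =
      (x : ℂ) ^ 2 * tOf σ := by
  rw [halfEdgeTerm_eq_single x σ (toSite (0, -1)) w_Q_1_0_0_0 (fun γ hγ => absurd (enum_Q_1_0_0 γ) hγ)]
  rw [if_neg (by decide), winding_support_medial w_Q_1_0_0_0.walk (toSite (0, -1)) (by decide),
    show quarterTurns (List.map ofSite w_Q_1_0_0_0.walk.support ++ [ofSite (toSite (0, -1))]) = 1 from by decide,
    show Literature.Probability.RandomPlanarGeometry.SAW.DomainSAW.length w_Q_1_0_0_0 = 1 from by decide, cexp_quarter_1 σ]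
  ring

/-- Value of one half-edge term of the mid-edge observable on the explicit domain (from the enumeration certificate and the integer winding count). [folklore] -/
theorem hET_Q_1_0_S_in (x σ : ℝ) :
    Literature.Probability.RandomPlanarGeometry.SAW.halfEdgeTerm OmQ 1 (toSite (1, 0)) x σ (toSite (0, -1)) (toSite (0, 0)) = 0 := by
  refine halfEdgeTerm_eq_zero x σ (toSite (0, 0)) fun γ => ?_
  rw [enum_Q_1_0_4 γ]; decide

/-- Value of the mid-edge observable at one of the four edges at the origin, on the explicit domain. [folklore] -/
theorem F_Q_1_0_E (x σ : ℝ) :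
    Literature.Probability.RandomPlanarGeometry.SAW.midEdgeParafermionicObservable OmQ 1 (toSite (1, 0)) x σ s(toSite (0, 0), toSite (1, 0)) =
      (x : ℂ) := by
  simp only [Literature.Probability.RandomPlanarGeometry.SAW.midEdgeParafermionicObservable_mk, hET_Q_1_0_E_out, hET_Q_1_0_E_in, zero_add]

/-- Value of the mid-edge observable at one of the four edges at the origin, on the explicit domain. [folklore] -/
theorem F_Q_1_0_N (x σ : ℝ) :
    Literature.Probability.RandomPlanarGeometry.SAW.midEdgeParafermionicObservable OmQ 1 (toSite (1, 0)) x σ s(toSite (0, 0), toSite (0, 1)) =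
      (x : ℂ) ^ 2 * (tOf σ)⁻¹ + (x : ℂ) ^ 5 * (tOf σ)⁻¹ ^ 3 := by
  simp only [Literature.Probability.RandomPlanarGeometry.SAW.midEdgeParafermionicObservable_mk, hET_Q_1_0_N_out, hET_Q_1_0_N_in]

/-- Value of the mid-edge observable at one of the four edges at the origin, on the explicit domain. [folklore] -/
theorem F_Q_1_0_W (x σ : ℝ) :
    Literature.Probability.RandomPlanarGeometry.SAW.midEdgeParafermionicObservable OmQ 1 (toSite (1, 0)) x σ s(toSite (0, 0), toSite (-1, 0)) =
      (x : ℂ) ^ 2 + (x : ℂ) ^ 5 * tOf σ ^ 2 := by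
  simp only [Literature.Probability.RandomPlanarGeometry.SAW.midEdgeParafermionicObservable_mk, hET_Q_1_0_W_out, hET_Q_1_0_W_in]

/-- Value of the mid-edge observable at one of the four edges at the origin, on the explicit domain. [folklore] -/
theorem F_Q_1_0_S (x σ : ℝ) :
    Literature.Probability.RandomPlanarGeometry.SAW.midEdgeParafermionicObservable OmQ 1 (toSite (1, 0)) x σ s(toSite (0, 0), toSite (0, -1)) =
      (x : ℂ) ^ 2 * tOf σ := by
  simp only [Literature.Probability.RandomPlanarGeometry.SAW.midEdgeParafermionicObservable_mk, hET_Q_1_0_S_out, hET_Q_1_0_S_in, add_zero]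

/-! #### Instance `Qb` (star-shaped), root `(1, 0)` -/

/-- explicit self-avoiding walk `(1,0) → (0,0)` [folklore] -/
def w_Qb_1_0_0_0 : Literature.Probability.RandomPlanarGeometry.SAW.DomainSAW OmQb 1 (toSite (1, 0)) (toSite (0, 0)) :=
  ⟨SimpleGraph.Walk.cons (goodQb.A (1, 0) (0, 0)) <|
  SimpleGraph.Walk.nil, (SimpleGraph.Walk.isPath_def _).2 (by decide)⟩

/-- Enumeration certificate: the self-avoiding walks between these endpoints are exactly the listed ones (completeness of `dfs` + `decide`). [folklore] -/
theorem enum_Qb_1_0_0 : ∀ γ : Literature.Probability.RandomPlanarGeometry.SAW.DomainSAW OmQb 1 (toSite (1, 0)) (toSite (0, 0)),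
    γ = w_Qb_1_0_0_0 := by
  intro γ
  have hmem := goodQb.support_mem_dfs γ (by decide) (fuel := 12) (by decide)
  have hhead := head?_reverse_map_support γ.walk
  have hall : ∀ l ∈ dfs QbE 12 [ofSite (toSite (1, 0))], l.head? = some (ofSite (toSite (0, 0))) →
      l = [(0, 0), (1, 0)] := by decide
  have h := hall _ hmem hhead
  apply DomainSAW_eq_of_support; rw [support_eq_of_reverse_map γ.walk h]; decide

/-- the trivial walk at the root [folklore] -/
def nil_Qb_1_0 : Literature.Probability.RandomPlanarGeometry.SAW.DomainSAW OmQb 1 (toSite (1, 0)) (toSite (1, 0)) := Literature.Probability.RandomPlanarGeometry.SAW.DomainSAW.nil _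

/-- Enumeration certificate: the self-avoiding walks between these endpoints are exactly the listed ones. [folklore] -/
theorem enum_Qb_1_0_1 : ∀ γ : Literature.Probability.RandomPlanarGeometry.SAW.DomainSAW OmQb 1 (toSite (1, 0)) (toSite (1, 0)), γ = nil_Qb_1_0 :=
  Literature.Probability.RandomPlanarGeometry.SAW.DomainSAW.eq_nil_of_self

/-- explicit self-avoiding walk `(1,0) → (0,0) → (0,1)` [folklore] -/
def w_Qb_1_0_2_0 : Literature.Probability.RandomPlanarGeometry.SAW.DomainSAW OmQb 1 (toSite (1, 0)) (toSite (0, 1)) :=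
  ⟨SimpleGraph.Walk.cons (goodQb.A (1, 0) (0, 0)) <|
  SimpleGraph.Walk.cons (goodQb.A (0, 0) (0, 1)) <|
  SimpleGraph.Walk.nil, (SimpleGraph.Walk.isPath_def _).2 (by decide)⟩

/-- Enumeration certificate: the self-avoiding walks between these endpoints are exactly the listed ones (completeness of `dfs` + `decide`). [folklore] -/
theorem enum_Qb_1_0_2 : ∀ γ : Literature.Probability.RandomPlanarGeometry.SAW.DomainSAW OmQb 1 (toSite (1, 0)) (toSite (0, 1)),
    γ = w_Qb_1_0_2_0 := by
  intro γ
  have hmem := goodQb.support_mem_dfs γ (by decide) (fuel := 12) (by decide)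
  have hhead := head?_reverse_map_support γ.walk
  have hall : ∀ l ∈ dfs QbE 12 [ofSite (toSite (1, 0))], l.head? = some (ofSite (toSite (0, 1))) →
      l = [(0, 1), (0, 0), (1, 0)] := by decide
  have h := hall _ hmem hhead
  apply DomainSAW_eq_of_support; rw [support_eq_of_reverse_map γ.walk h]; decide

/-- explicit self-avoiding walk `(1,0) → (0,0) → (-1,0)` [folklore] -/
def w_Qb_1_0_3_0 : Literature.Probability.RandomPlanarGeometry.SAW.DomainSAW OmQb 1 (toSite (1, 0)) (toSite (-1, 0)) :=
  ⟨SimpleGraph.Walk.cons (goodQb.A (1, 0) (0, 0)) <|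
  SimpleGraph.Walk.cons (goodQb.A (0, 0) (-1, 0)) <|
  SimpleGraph.Walk.nil, (SimpleGraph.Walk.isPath_def _).2 (by decide)⟩

/-- explicit self-avoiding walk `(1,0) → (0,0) → (0,-1) → (-1,-1) → (-1,0)` [folklore] -/
def w_Qb_1_0_3_1 : Literature.Probability.RandomPlanarGeometry.SAW.DomainSAW OmQb 1 (toSite (1, 0)) (toSite (-1, 0)) :=
  ⟨SimpleGraph.Walk.cons (goodQb.A (1, 0) (0, 0)) <|
  SimpleGraph.Walk.cons (goodQb.A (0, 0) (0, -1)) <|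
  SimpleGraph.Walk.cons (goodQb.A (0, -1) (-1, -1)) <|
  SimpleGraph.Walk.cons (goodQb.A (-1, -1) (-1, 0)) <|
  SimpleGraph.Walk.nil, (SimpleGraph.Walk.isPath_def _).2 (by decide)⟩

/-- Enumeration certificate: the self-avoiding walks between these endpoints are exactly the listed ones (completeness of `dfs` + `decide`). [folklore] -/
theorem enum_Qb_1_0_3 : ∀ γ : Literature.Probability.RandomPlanarGeometry.SAW.DomainSAW OmQb 1 (toSite (1, 0)) (toSite (-1, 0)),
    γ = w_Qb_1_0_3_0 ∨ γ = w_Qb_1_0_3_1 := by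
  intro γ
  have hmem := goodQb.support_mem_dfs γ (by decide) (fuel := 12) (by decide)
  have hhead := head?_reverse_map_support γ.walk
  have hall : ∀ l ∈ dfs QbE 12 [ofSite (toSite (1, 0))], l.head? = some (ofSite (toSite (-1, 0))) →
      l = [(-1, 0), (0, 0), (1, 0)] ∨ l = [(-1, 0), (-1, -1), (0, -1), (0, 0), (1, 0)] := by decide
  rcases hall _ hmem hhead with h | h
  · left; apply DomainSAW_eq_of_support; rw [support_eq_of_reverse_map γ.walk h]; decide
  · right; apply DomainSAW_eq_of_support; rw [support_eq_of_reverse_map γ.walk h]; decide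

/-- explicit self-avoiding walk `(1,0) → (0,0) → (-1,0) → (-1,-1) → (0,-1)` [folklore] -/
def w_Qb_1_0_4_0 : Literature.Probability.RandomPlanarGeometry.SAW.DomainSAW OmQb 1 (toSite (1, 0)) (toSite (0, -1)) :=
  ⟨SimpleGraph.Walk.cons (goodQb.A (1, 0) (0, 0)) <|
  SimpleGraph.Walk.cons (goodQb.A (0, 0) (-1, 0)) <|
  SimpleGraph.Walk.cons (goodQb.A (-1, 0) (-1, -1)) <|
  SimpleGraph.Walk.cons (goodQb.A (-1, -1) (0, -1)) <|
  SimpleGraph.Walk.nil, (SimpleGraph.Walk.isPath_def _).2 (by decide)⟩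

/-- explicit self-avoiding walk `(1,0) → (0,0) → (0,-1)` [folklore] -/
def w_Qb_1_0_4_1 : Literature.Probability.RandomPlanarGeometry.SAW.DomainSAW OmQb 1 (toSite (1, 0)) (toSite (0, -1)) :=
  ⟨SimpleGraph.Walk.cons (goodQb.A (1, 0) (0, 0)) <|
  SimpleGraph.Walk.cons (goodQb.A (0, 0) (0, -1)) <|
  SimpleGraph.Walk.nil, (SimpleGraph.Walk.isPath_def _).2 (by decide)⟩

/-- Enumeration certificate: the self-avoiding walks between these endpoints are exactly the listed ones (completeness of `dfs` + `decide`). [folklore] -/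
theorem enum_Qb_1_0_4 : ∀ γ : Literature.Probability.RandomPlanarGeometry.SAW.DomainSAW OmQb 1 (toSite (1, 0)) (toSite (0, -1)),
    γ = w_Qb_1_0_4_0 ∨ γ = w_Qb_1_0_4_1 := by
  intro γ
  have hmem := goodQb.support_mem_dfs γ (by decide) (fuel := 12) (by decide)
  have hhead := head?_reverse_map_support γ.walk
  have hall : ∀ l ∈ dfs QbE 12 [ofSite (toSite (1, 0))], l.head? = some (ofSite (toSite (0, -1))) →
      l = [(0, -1), (-1, -1), (-1, 0), (0, 0), (1, 0)] ∨ l = [(0, -1), (0, 0), (1, 0)] := by decide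
  rcases hall _ hmem hhead with h | h
  · left; apply DomainSAW_eq_of_support; rw [support_eq_of_reverse_map γ.walk h]; decide
  · right; apply DomainSAW_eq_of_support; rw [support_eq_of_reverse_map γ.walk h]; decide

/-- Value of one half-edge term of the mid-edge observable on the explicit domain (from the enumeration certificate and the integer winding count). [folklore] -/
theorem hET_Qb_1_0_E_out (x σ : ℝ) :
    Literature.Probability.RandomPlanarGeometry.SAW.halfEdgeTerm OmQb 1 (toSite (1, 0)) x σ (toSite (0, 0)) (toSite (1, 0)) = 0 := by
  refine halfEdgeTerm_eq_zero x σ (toSite (1, 0)) fun γ => ?_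
  rw [enum_Qb_1_0_0 γ]; decide

/-- Value of one half-edge term of the mid-edge observable on the explicit domain (from the enumeration certificate and the integer winding count). [folklore] -/
theorem hET_Qb_1_0_E_in (x σ : ℝ) :
    Literature.Probability.RandomPlanarGeometry.SAW.halfEdgeTerm OmQb 1 (toSite (1, 0)) x σ (toSite (1, 0)) (toSite (0, 0)) =
      (x : ℂ) := by
  rw [halfEdgeTerm_eq_single x σ (toSite (0, 0)) nil_Qb_1_0 (fun γ hγ => absurd (enum_Qb_1_0_1 γ) hγ)]
  rw [if_neg (by decide), winding_support_medial nil_Qb_1_0.walk (toSite (0, 0)) (by decide),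
    show quarterTurns (List.map ofSite nil_Qb_1_0.walk.support ++ [ofSite (toSite (0, 0))]) = 0 from by decide,
    show Literature.Probability.RandomPlanarGeometry.SAW.DomainSAW.length nil_Qb_1_0 = 0 from by decide, cexp_quarter_0 σ]
  ring

/-- Value of one half-edge term of the mid-edge observable on the explicit domain (from the enumeration certificate and the integer winding count). [folklore] -/
theorem hET_Qb_1_0_N_out (x σ : ℝ) :
    Literature.Probability.RandomPlanarGeometry.SAW.halfEdgeTerm OmQb 1 (toSite (1, 0)) x σ (toSite (0, 0)) (toSite (0, 1)) =
      (x : ℂ) ^ 2 * (tOf σ)⁻¹ := by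
  rw [halfEdgeTerm_eq_single x σ (toSite (0, 1)) w_Qb_1_0_0_0 (fun γ hγ => absurd (enum_Qb_1_0_0 γ) hγ)]
  rw [if_neg (by decide), winding_support_medial w_Qb_1_0_0_0.walk (toSite (0, 1)) (by decide),
    show quarterTurns (List.map ofSite w_Qb_1_0_0_0.walk.support ++ [ofSite (toSite (0, 1))]) = -1 from by decide,
    show Literature.Probability.RandomPlanarGeometry.SAW.DomainSAW.length w_Qb_1_0_0_0 = 1 from by decide, cexp_quarter_m1 σ]
  ring

/-- Value of one half-edge term of the mid-edge observable on the explicit domain (from the enumeration certificate and the integer winding count). [folklore] -/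
theorem hET_Qb_1_0_N_in (x σ : ℝ) :
    Literature.Probability.RandomPlanarGeometry.SAW.halfEdgeTerm OmQb 1 (toSite (1, 0)) x σ (toSite (0, 1)) (toSite (0, 0)) = 0 := by
  refine halfEdgeTerm_eq_zero x σ (toSite (0, 0)) fun γ => ?_
  rw [enum_Qb_1_0_2 γ]; decide

/-- Value of one half-edge term of the mid-edge observable on the explicit domain (from the enumeration certificate and the integer winding count). [folklore] -/
theorem hET_Qb_1_0_W_out (x σ : ℝ) :
    Literature.Probability.RandomPlanarGeometry.SAW.halfEdgeTerm OmQb 1 (toSite (1, 0)) x σ (toSite (0, 0)) (toSite (-1, 0)) =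
      (x : ℂ) ^ 2 := by
  rw [halfEdgeTerm_eq_single x σ (toSite (-1, 0)) w_Qb_1_0_0_0 (fun γ hγ => absurd (enum_Qb_1_0_0 γ) hγ)]
  rw [if_neg (by decide), winding_support_medial w_Qb_1_0_0_0.walk (toSite (-1, 0)) (by decide),
    show quarterTurns (List.map ofSite w_Qb_1_0_0_0.walk.support ++ [ofSite (toSite (-1, 0))]) = 0 from by decide,
    show Literature.Probability.RandomPlanarGeometry.SAW.DomainSAW.length w_Qb_1_0_0_0 = 1 from by decide, cexp_quarter_0 σ]
  ring

/-- Value of one half-edge term of the mid-edge observable on the explicit domain (from the enumeration certificate and the integer winding count). [folklore] -/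
theorem hET_Qb_1_0_W_in (x σ : ℝ) :
    Literature.Probability.RandomPlanarGeometry.SAW.halfEdgeTerm OmQb 1 (toSite (1, 0)) x σ (toSite (-1, 0)) (toSite (0, 0)) =
      (x : ℂ) ^ 5 * (tOf σ)⁻¹ ^ 2 := by
  rw [halfEdgeTerm_eq_single x σ (toSite (0, 0)) w_Qb_1_0_3_1 (fun γ hγ => by
    rcases enum_Qb_1_0_3 γ with rfl | rfl
    · decide
    · exact absurd rfl hγ
    )]
  rw [if_neg (by decide), winding_support_medial w_Qb_1_0_3_1.walk (toSite (0, 0)) (by decide),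
    show quarterTurns (List.map ofSite w_Qb_1_0_3_1.walk.support ++ [ofSite (toSite (0, 0))]) = -2 from by decide,
    show Literature.Probability.RandomPlanarGeometry.SAW.DomainSAW.length w_Qb_1_0_3_1 = 4 from by decide, cexp_quarter_m2 σ]
  ring

/-- Value of one half-edge term of the mid-edge observable on the explicit domain (from the enumeration certificate and the integer winding count). [folklore] -/
theorem hET_Qb_1_0_S_out (x σ : ℝ) :
    Literature.Probability.RandomPlanarGeometry.SAW.halfEdgeTerm OmQb 1 (toSite (1, 0)) x σ (toSite (0, 0)) (toSite (0, -1)) =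
      (x : ℂ) ^ 2 * tOf σ := by
  rw [halfEdgeTerm_eq_single x σ (toSite (0, -1)) w_Qb_1_0_0_0 (fun γ hγ => absurd (enum_Qb_1_0_0 γ) hγ)]
  rw [if_neg (by decide), winding_support_medial w_Qb_1_0_0_0.walk (toSite (0, -1)) (by decide),
    show quarterTurns (List.map ofSite w_Qb_1_0_0_0.walk.support ++ [ofSite (toSite (0, -1))]) = 1 from by decide,
    show Literature.Probability.RandomPlanarGeometry.SAW.DomainSAW.length w_Qb_1_0_0_0 = 1 from by decide, cexp_quarter_1 σ]
  ring

/-- Value of one half-edge term of the mid-edge observable on the explicit domain (from the enumeration certificate and the integer winding count). [folklore] -/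
theorem hET_Qb_1_0_S_in (x σ : ℝ) :
    Literature.Probability.RandomPlanarGeometry.SAW.halfEdgeTerm OmQb 1 (toSite (1, 0)) x σ (toSite (0, -1)) (toSite (0, 0)) =
      (x : ℂ) ^ 5 * tOf σ ^ 3 := by
  rw [halfEdgeTerm_eq_single x σ (toSite (0, 0)) w_Qb_1_0_4_0 (fun γ hγ => by
    rcases enum_Qb_1_0_4 γ with rfl | rfl
    · exact absurd rfl hγ
    · decide
    )]
  rw [if_neg (by decide), winding_support_medial w_Qb_1_0_4_0.walk (toSite (0, 0)) (by decide),
    show quarterTurns (List.map ofSite w_Qb_1_0_4_0.walk.support ++ [ofSite (toSite (0, 0))]) = 3 from by decide,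
    show Literature.Probability.RandomPlanarGeometry.SAW.DomainSAW.length w_Qb_1_0_4_0 = 4 from by decide, cexp_quarter_3 σ]
  ring

/-- Value of the mid-edge observable at one of the four edges at the origin, on the explicit domain. [folklore] -/
theorem F_Qb_1_0_E (x σ : ℝ) :
    Literature.Probability.RandomPlanarGeometry.SAW.midEdgeParafermionicObservable OmQb 1 (toSite (1, 0)) x σ s(toSite (0, 0), toSite (1, 0)) =
      (x : ℂ) := by
  simp only [Literature.Probability.RandomPlanarGeometry.SAW.midEdgeParafermionicObservable_mk, hET_Qb_1_0_E_out, hET_Qb_1_0_E_in, zero_add]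

/-- Value of the mid-edge observable at one of the four edges at the origin, on the explicit domain. [folklore] -/
theorem F_Qb_1_0_N (x σ : ℝ) :
    Literature.Probability.RandomPlanarGeometry.SAW.midEdgeParafermionicObservable OmQb 1 (toSite (1, 0)) x σ s(toSite (0, 0), toSite (0, 1)) =
      (x : ℂ) ^ 2 * (tOf σ)⁻¹ := by
  simp only [Literature.Probability.RandomPlanarGeometry.SAW.midEdgeParafermionicObservable_mk, hET_Qb_1_0_N_out, hET_Qb_1_0_N_in, add_zero]

/-- Value of the mid-edge observable at one of the four edges at the origin, on the explicit domain. [folklore] -/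
theorem F_Qb_1_0_W (x σ : ℝ) :
    Literature.Probability.RandomPlanarGeometry.SAW.midEdgeParafermionicObservable OmQb 1 (toSite (1, 0)) x σ s(toSite (0, 0), toSite (-1, 0)) =
      (x : ℂ) ^ 2 + (x : ℂ) ^ 5 * (tOf σ)⁻¹ ^ 2 := by
  simp only [Literature.Probability.RandomPlanarGeometry.SAW.midEdgeParafermionicObservable_mk, hET_Qb_1_0_W_out, hET_Qb_1_0_W_in]

/-- Value of the mid-edge observable at one of the four edges at the origin, on the explicit domain. [folklore] -/
theorem F_Qb_1_0_S (x σ : ℝ) :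
    Literature.Probability.RandomPlanarGeometry.SAW.midEdgeParafermionicObservable OmQb 1 (toSite (1, 0)) x σ s(toSite (0, 0), toSite (0, -1)) =
      (x : ℂ) ^ 2 * tOf σ + (x : ℂ) ^ 5 * tOf σ ^ 3 := by
  simp only [Literature.Probability.RandomPlanarGeometry.SAW.midEdgeParafermionicObservable_mk, hET_Qb_1_0_S_out, hET_Qb_1_0_S_in]

/-! #### Instance `O2` (star-shaped), root `(1, 0)` -/

/-- explicit self-avoiding walk `(1,0) → (0,0)` [folklore] -/
def w_O2_1_0_0_0 : Literature.Probability.RandomPlanarGeometry.SAW.DomainSAW OmO2 1 (toSite (1, 0)) (toSite (0, 0)) :=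
  ⟨SimpleGraph.Walk.cons (goodO2.A (1, 0) (0, 0)) <|
  SimpleGraph.Walk.nil, (SimpleGraph.Walk.isPath_def _).2 (by decide)⟩

/-- Enumeration certificate: the self-avoiding walks between these endpoints are exactly the listed ones (completeness of `dfs` + `decide`). [folklore] -/
theorem enum_O2_1_0_0 : ∀ γ : Literature.Probability.RandomPlanarGeometry.SAW.DomainSAW OmO2 1 (toSite (1, 0)) (toSite (0, 0)),
    γ = w_O2_1_0_0_0 := by
  intro γ
  have hmem := goodO2.support_mem_dfs γ (by decide) (fuel := 16) (by decide)
  have hhead := head?_reverse_map_support γ.walk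
  have hall : ∀ l ∈ dfs O2E 16 [ofSite (toSite (1, 0))], l.head? = some (ofSite (toSite (0, 0))) →
      l = [(0, 0), (1, 0)] := by decide
  have h := hall _ hmem hhead
  apply DomainSAW_eq_of_support; rw [support_eq_of_reverse_map γ.walk h]; decide

/-- the trivial walk at the root [folklore] -/
def nil_O2_1_0 : Literature.Probability.RandomPlanarGeometry.SAW.DomainSAW OmO2 1 (toSite (1, 0)) (toSite (1, 0)) := Literature.Probability.RandomPlanarGeometry.SAW.DomainSAW.nil _

/-- Enumeration certificate: the self-avoiding walks between these endpoints are exactly the listed ones. [folklore] -/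
theorem enum_O2_1_0_1 : ∀ γ : Literature.Probability.RandomPlanarGeometry.SAW.DomainSAW OmO2 1 (toSite (1, 0)) (toSite (1, 0)), γ = nil_O2_1_0 :=
  Literature.Probability.RandomPlanarGeometry.SAW.DomainSAW.eq_nil_of_self

/-- explicit self-avoiding walk `(1,0) → (0,0) → (0,1)` [folklore] -/
def w_O2_1_0_2_0 : Literature.Probability.RandomPlanarGeometry.SAW.DomainSAW OmO2 1 (toSite (1, 0)) (toSite (0, 1)) :=
  ⟨SimpleGraph.Walk.cons (goodO2.A (1, 0) (0, 0)) <|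
  SimpleGraph.Walk.cons (goodO2.A (0, 0) (0, 1)) <|
  SimpleGraph.Walk.nil, (SimpleGraph.Walk.isPath_def _).2 (by decide)⟩

/-- explicit self-avoiding walk `(1,0) → (0,0) → (-1,0) → (-1,1) → (0,1)` [folklore] -/
def w_O2_1_0_2_1 : Literature.Probability.RandomPlanarGeometry.SAW.DomainSAW OmO2 1 (toSite (1, 0)) (toSite (0, 1)) :=
  ⟨SimpleGraph.Walk.cons (goodO2.A (1, 0) (0, 0)) <|
  SimpleGraph.Walk.cons (goodO2.A (0, 0) (-1, 0)) <|
  SimpleGraph.Walk.cons (goodO2.A (-1, 0) (-1, 1)) <|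
  SimpleGraph.Walk.cons (goodO2.A (-1, 1) (0, 1)) <|
  SimpleGraph.Walk.nil, (SimpleGraph.Walk.isPath_def _).2 (by decide)⟩

/-- explicit self-avoiding walk `(1,0) → (0,0) → (0,-1) → (-1,-1) → (-1,0) → (-1,1) → (0,1)` [folklore] -/
def w_O2_1_0_2_2 : Literature.Probability.RandomPlanarGeometry.SAW.DomainSAW OmO2 1 (toSite (1, 0)) (toSite (0, 1)) :=
  ⟨SimpleGraph.Walk.cons (goodO2.A (1, 0) (0, 0)) <|
  SimpleGraph.Walk.cons (goodO2.A (0, 0) (0, -1)) <|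
  SimpleGraph.Walk.cons (goodO2.A (0, -1) (-1, -1)) <|
  SimpleGraph.Walk.cons (goodO2.A (-1, -1) (-1, 0)) <|
  SimpleGraph.Walk.cons (goodO2.A (-1, 0) (-1, 1)) <|
  SimpleGraph.Walk.cons (goodO2.A (-1, 1) (0, 1)) <|
  SimpleGraph.Walk.nil, (SimpleGraph.Walk.isPath_def _).2 (by decide)⟩

/-- Enumeration certificate: the self-avoiding walks between these endpoints are exactly the listed ones (completeness of `dfs` + `decide`). [folklore] -/
theorem enum_O2_1_0_2 : ∀ γ : Literature.Probability.RandomPlanarGeometry.SAW.DomainSAW OmO2 1 (toSite (1, 0)) (toSite (0, 1)),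
    γ = w_O2_1_0_2_0 ∨ γ = w_O2_1_0_2_1 ∨ γ = w_O2_1_0_2_2 := by
  intro γ
  have hmem := goodO2.support_mem_dfs γ (by decide) (fuel := 16) (by decide)
  have hhead := head?_reverse_map_support γ.walk
  have hall : ∀ l ∈ dfs O2E 16 [ofSite (toSite (1, 0))], l.head? = some (ofSite (toSite (0, 1))) →
      l = [(0, 1), (0, 0), (1, 0)] ∨ l = [(0, 1), (-1, 1), (-1, 0), (0, 0), (1, 0)] ∨ l = [(0, 1), (-1, 1), (-1, 0), (-1, -1), (0, -1), (0, 0), (1, 0)] := by decide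
  rcases hall _ hmem hhead with h | h | h
  · left; apply DomainSAW_eq_of_support; rw [support_eq_of_reverse_map γ.walk h]; decide
  · right; left; apply DomainSAW_eq_of_support; rw [support_eq_of_reverse_map γ.walk h]; decide
  · right; right; apply DomainSAW_eq_of_support; rw [support_eq_of_reverse_map γ.walk h]; decide

/-- explicit self-avoiding walk `(1,0) → (0,0) → (0,1) → (-1,1) → (-1,0)` [folklore] -/
def w_O2_1_0_3_0 : Literature.Probability.RandomPlanarGeometry.SAW.DomainSAW OmO2 1 (toSite (1, 0)) (toSite (-1, 0)) :=
  ⟨SimpleGraph.Walk.cons (goodO2.A (1, 0) (0, 0)) <|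
  SimpleGraph.Walk.cons (goodO2.A (0, 0) (0, 1)) <|
  SimpleGraph.Walk.cons (goodO2.A (0, 1) (-1, 1)) <|
  SimpleGraph.Walk.cons (goodO2.A (-1, 1) (-1, 0)) <|
  SimpleGraph.Walk.nil, (SimpleGraph.Walk.isPath_def _).2 (by decide)⟩

/-- explicit self-avoiding walk `(1,0) → (0,0) → (-1,0)` [folklore] -/
def w_O2_1_0_3_1 : Literature.Probability.RandomPlanarGeometry.SAW.DomainSAW OmO2 1 (toSite (1, 0)) (toSite (-1, 0)) :=
  ⟨SimpleGraph.Walk.cons (goodO2.A (1, 0) (0, 0)) <|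
  SimpleGraph.Walk.cons (goodO2.A (0, 0) (-1, 0)) <|
  SimpleGraph.Walk.nil, (SimpleGraph.Walk.isPath_def _).2 (by decide)⟩

/-- explicit self-avoiding walk `(1,0) → (0,0) → (0,-1) → (-1,-1) → (-1,0)` [folklore] -/
def w_O2_1_0_3_2 : Literature.Probability.RandomPlanarGeometry.SAW.DomainSAW OmO2 1 (toSite (1, 0)) (toSite (-1, 0)) :=
  ⟨SimpleGraph.Walk.cons (goodO2.A (1, 0) (0, 0)) <|
  SimpleGraph.Walk.cons (goodO2.A (0, 0) (0, -1)) <|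
  SimpleGraph.Walk.cons (goodO2.A (0, -1) (-1, -1)) <|
  SimpleGraph.Walk.cons (goodO2.A (-1, -1) (-1, 0)) <|
  SimpleGraph.Walk.nil, (SimpleGraph.Walk.isPath_def _).2 (by decide)⟩

/-- Enumeration certificate: the self-avoiding walks between these endpoints are exactly the listed ones (completeness of `dfs` + `decide`). [folklore] -/
theorem enum_O2_1_0_3 : ∀ γ : Literature.Probability.RandomPlanarGeometry.SAW.DomainSAW OmO2 1 (toSite (1, 0)) (toSite (-1, 0)),
    γ = w_O2_1_0_3_0 ∨ γ = w_O2_1_0_3_1 ∨ γ = w_O2_1_0_3_2 := by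
  intro γ
  have hmem := goodO2.support_mem_dfs γ (by decide) (fuel := 16) (by decide)
  have hhead := head?_reverse_map_support γ.walk
  have hall : ∀ l ∈ dfs O2E 16 [ofSite (toSite (1, 0))], l.head? = some (ofSite (toSite (-1, 0))) →
      l = [(-1, 0), (-1, 1), (0, 1), (0, 0), (1, 0)] ∨ l = [(-1, 0), (0, 0), (1, 0)] ∨ l = [(-1, 0), (-1, -1), (0, -1), (0, 0), (1, 0)] := by decide
  rcases hall _ hmem hhead with h | h | h
  · left; apply DomainSAW_eq_of_support; rw [support_eq_of_reverse_map γ.walk h]; decide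
  · right; left; apply DomainSAW_eq_of_support; rw [support_eq_of_reverse_map γ.walk h]; decide
  · right; right; apply DomainSAW_eq_of_support; rw [support_eq_of_reverse_map γ.walk h]; decide

/-- explicit self-avoiding walk `(1,0) → (0,0) → (0,1) → (-1,1) → (-1,0) → (-1,-1) → (0,-1)` [folklore] -/
def w_O2_1_0_4_0 : Literature.Probability.RandomPlanarGeometry.SAW.DomainSAW OmO2 1 (toSite (1, 0)) (toSite (0, -1)) :=
  ⟨SimpleGraph.Walk.cons (goodO2.A (1, 0) (0, 0)) <|
  SimpleGraph.Walk.cons (goodO2.A (0, 0) (0, 1)) <|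
  SimpleGraph.Walk.cons (goodO2.A (0, 1) (-1, 1)) <|
  SimpleGraph.Walk.cons (goodO2.A (-1, 1) (-1, 0)) <|
  SimpleGraph.Walk.cons (goodO2.A (-1, 0) (-1, -1)) <|
  SimpleGraph.Walk.cons (goodO2.A (-1, -1) (0, -1)) <|
  SimpleGraph.Walk.nil, (SimpleGraph.Walk.isPath_def _).2 (by decide)⟩

/-- explicit self-avoiding walk `(1,0) → (0,0) → (-1,0) → (-1,-1) → (0,-1)` [folklore] -/
def w_O2_1_0_4_1 : Literature.Probability.RandomPlanarGeometry.SAW.DomainSAW OmO2 1 (toSite (1, 0)) (toSite (0, -1)) :=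
  ⟨SimpleGraph.Walk.cons (goodO2.A (1, 0) (0, 0)) <|
  SimpleGraph.Walk.cons (goodO2.A (0, 0) (-1, 0)) <|
  SimpleGraph.Walk.cons (goodO2.A (-1, 0) (-1, -1)) <|
  SimpleGraph.Walk.cons (goodO2.A (-1, -1) (0, -1)) <|
  SimpleGraph.Walk.nil, (SimpleGraph.Walk.isPath_def _).2 (by decide)⟩

/-- explicit self-avoiding walk `(1,0) → (0,0) → (0,-1)` [folklore] -/
def w_O2_1_0_4_2 : Literature.Probability.RandomPlanarGeometry.SAW.DomainSAW OmO2 1 (toSite (1, 0)) (toSite (0, -1)) :=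
  ⟨SimpleGraph.Walk.cons (goodO2.A (1, 0) (0, 0)) <|
  SimpleGraph.Walk.cons (goodO2.A (0, 0) (0, -1)) <|
  SimpleGraph.Walk.nil, (SimpleGraph.Walk.isPath_def _).2 (by decide)⟩

/-- Enumeration certificate: the self-avoiding walks between these endpoints are exactly the listed ones (completeness of `dfs` + `decide`). [folklore] -/
theorem enum_O2_1_0_4 : ∀ γ : Literature.Probability.RandomPlanarGeometry.SAW.DomainSAW OmO2 1 (toSite (1, 0)) (toSite (0, -1)),
    γ = w_O2_1_0_4_0 ∨ γ = w_O2_1_0_4_1 ∨ γ = w_O2_1_0_4_2 := by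
  intro γ
  have hmem := goodO2.support_mem_dfs γ (by decide) (fuel := 16) (by decide)
  have hhead := head?_reverse_map_support γ.walk
  have hall : ∀ l ∈ dfs O2E 16 [ofSite (toSite (1, 0))], l.head? = some (ofSite (toSite (0, -1))) →
      l = [(0, -1), (-1, -1), (-1, 0), (-1, 1), (0, 1), (0, 0), (1, 0)] ∨ l = [(0, -1), (-1, -1), (-1, 0), (0, 0), (1, 0)] ∨ l = [(0, -1), (0, 0), (1, 0)] := by decide
  rcases hall _ hmem hhead with h | h | h
  · left; apply DomainSAW_eq_of_support; rw [support_eq_of_reverse_map γ.walk h]; decide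
  · right; left; apply DomainSAW_eq_of_support; rw [support_eq_of_reverse_map γ.walk h]; decide
  · right; right; apply DomainSAW_eq_of_support; rw [support_eq_of_reverse_map γ.walk h]; decide

/-- Value of one half-edge term of the mid-edge observable on the explicit domain (from the enumeration certificate and the integer winding count). [folklore] -/
theorem hET_O2_1_0_E_out (x σ : ℝ) :
    Literature.Probability.RandomPlanarGeometry.SAW.halfEdgeTerm OmO2 1 (toSite (1, 0)) x σ (toSite (0, 0)) (toSite (1, 0)) = 0 := by
  refine halfEdgeTerm_eq_zero x σ (toSite (1, 0)) fun γ => ?_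
  rw [enum_O2_1_0_0 γ]; decide

/-- Value of one half-edge term of the mid-edge observable on the explicit domain (from the enumeration certificate and the integer winding count). [folklore] -/
theorem hET_O2_1_0_E_in (x σ : ℝ) :
    Literature.Probability.RandomPlanarGeometry.SAW.halfEdgeTerm OmO2 1 (toSite (1, 0)) x σ (toSite (1, 0)) (toSite (0, 0)) =
      (x : ℂ) := by
  rw [halfEdgeTerm_eq_single x σ (toSite (0, 0)) nil_O2_1_0 (fun γ hγ => absurd (enum_O2_1_0_1 γ) hγ)]
  rw [if_neg (by decide), winding_support_medial nil_O2_1_0.walk (toSite (0, 0)) (by decide),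
    show quarterTurns (List.map ofSite nil_O2_1_0.walk.support ++ [ofSite (toSite (0, 0))]) = 0 from by decide,
    show Literature.Probability.RandomPlanarGeometry.SAW.DomainSAW.length nil_O2_1_0 = 0 from by decide, cexp_quarter_0 σ]
  ring

/-- Value of one half-edge term of the mid-edge observable on the explicit domain (from the enumeration certificate and the integer winding count). [folklore] -/
theorem hET_O2_1_0_N_out (x σ : ℝ) :
    Literature.Probability.RandomPlanarGeometry.SAW.halfEdgeTerm OmO2 1 (toSite (1, 0)) x σ (toSite (0, 0)) (toSite (0, 1)) =
      (x : ℂ) ^ 2 * (tOf σ)⁻¹ := by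
  rw [halfEdgeTerm_eq_single x σ (toSite (0, 1)) w_O2_1_0_0_0 (fun γ hγ => absurd (enum_O2_1_0_0 γ) hγ)]
  rw [if_neg (by decide), winding_support_medial w_O2_1_0_0_0.walk (toSite (0, 1)) (by decide),
    show quarterTurns (List.map ofSite w_O2_1_0_0_0.walk.support ++ [ofSite (toSite (0, 1))]) = -1 from by decide,
    show Literature.Probability.RandomPlanarGeometry.SAW.DomainSAW.length w_O2_1_0_0_0 = 1 from by decide, cexp_quarter_m1 σ]
  ring

/-- Value of one half-edge term of the mid-edge observable on the explicit domain (from the enumeration certificate and the integer winding count). [folklore] -/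
theorem hET_O2_1_0_N_in (x σ : ℝ) :
    Literature.Probability.RandomPlanarGeometry.SAW.halfEdgeTerm OmO2 1 (toSite (1, 0)) x σ (toSite (0, 1)) (toSite (0, 0)) =
      (x : ℂ) ^ 5 * (tOf σ)⁻¹ ^ 3 + (x : ℂ) ^ 7 * (tOf σ)⁻¹ ^ 3 := by
  rw [halfEdgeTerm_eq_pair x σ (toSite (0, 0)) w_O2_1_0_2_1 w_O2_1_0_2_2
    (ne_of_apply_ne (fun γ => List.map ofSite γ.walk.support) (by decide))
    (fun γ h1 h2 => by
      rcases enum_O2_1_0_2 γ with rfl | rfl | rfl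
      · decide
      · exact absurd rfl h1
      · exact absurd rfl h2)]
  rw [if_neg (by decide), if_neg (by decide),
    winding_support_medial w_O2_1_0_2_1.walk (toSite (0, 0)) (by decide),
    winding_support_medial w_O2_1_0_2_2.walk (toSite (0, 0)) (by decide),
    show quarterTurns (List.map ofSite w_O2_1_0_2_1.walk.support ++ [ofSite (toSite (0, 0))]) = -3 from by decide,
    show quarterTurns (List.map ofSite w_O2_1_0_2_2.walk.support ++ [ofSite (toSite (0, 0))]) = -3 from by decide,
    show Literature.Probability.RandomPlanarGeometry.SAW.DomainSAW.length w_O2_1_0_2_1 = 4 from by decide, show Literature.Probability.RandomPlanarGeometry.SAW.DomainSAW.length w_O2_1_0_2_2 = 6 from by decide,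
    cexp_quarter_m3 σ]
  ring

/-- Value of one half-edge term of the mid-edge observable on the explicit domain (from the enumeration certificate and the integer winding count). [folklore] -/
theorem hET_O2_1_0_W_out (x σ : ℝ) :
    Literature.Probability.RandomPlanarGeometry.SAW.halfEdgeTerm OmO2 1 (toSite (1, 0)) x σ (toSite (0, 0)) (toSite (-1, 0)) =
      (x : ℂ) ^ 2 := by
  rw [halfEdgeTerm_eq_single x σ (toSite (-1, 0)) w_O2_1_0_0_0 (fun γ hγ => absurd (enum_O2_1_0_0 γ) hγ)]
  rw [if_neg (by decide), winding_support_medial w_O2_1_0_0_0.walk (toSite (-1, 0)) (by decide),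
    show quarterTurns (List.map ofSite w_O2_1_0_0_0.walk.support ++ [ofSite (toSite (-1, 0))]) = 0 from by decide,
    show Literature.Probability.RandomPlanarGeometry.SAW.DomainSAW.length w_O2_1_0_0_0 = 1 from by decide, cexp_quarter_0 σ]
  ring

/-- Value of one half-edge term of the mid-edge observable on the explicit domain (from the enumeration certificate and the integer winding count). [folklore] -/
theorem hET_O2_1_0_W_in (x σ : ℝ) :
    Literature.Probability.RandomPlanarGeometry.SAW.halfEdgeTerm OmO2 1 (toSite (1, 0)) x σ (toSite (-1, 0)) (toSite (0, 0)) =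
      (x : ℂ) ^ 5 * tOf σ ^ 2 + (x : ℂ) ^ 5 * (tOf σ)⁻¹ ^ 2 := by
  rw [halfEdgeTerm_eq_pair x σ (toSite (0, 0)) w_O2_1_0_3_0 w_O2_1_0_3_2
    (ne_of_apply_ne (fun γ => List.map ofSite γ.walk.support) (by decide))
    (fun γ h1 h2 => by
      rcases enum_O2_1_0_3 γ with rfl | rfl | rfl
      · exact absurd rfl h1
      · decide
      · exact absurd rfl h2)]
  rw [if_neg (by decide), if_neg (by decide),
    winding_support_medial w_O2_1_0_3_0.walk (toSite (0, 0)) (by decide),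
    winding_support_medial w_O2_1_0_3_2.walk (toSite (0, 0)) (by decide),
    show quarterTurns (List.map ofSite w_O2_1_0_3_0.walk.support ++ [ofSite (toSite (0, 0))]) = 2 from by decide,
    show quarterTurns (List.map ofSite w_O2_1_0_3_2.walk.support ++ [ofSite (toSite (0, 0))]) = -2 from by decide,
    show Literature.Probability.RandomPlanarGeometry.SAW.DomainSAW.length w_O2_1_0_3_0 = 4 from by decide, show Literature.Probability.RandomPlanarGeometry.SAW.DomainSAW.length w_O2_1_0_3_2 = 4 from by decide,
    cexp_quarter_2 σ, cexp_quarter_m2 σ]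
  ring

/-- Value of one half-edge term of the mid-edge observable on the explicit domain (from the enumeration certificate and the integer winding count). [folklore] -/
theorem hET_O2_1_0_S_out (x σ : ℝ) :
    Literature.Probability.RandomPlanarGeometry.SAW.halfEdgeTerm OmO2 1 (toSite (1, 0)) x σ (toSite (0, 0)) (toSite (0, -1)) =
      (x : ℂ) ^ 2 * tOf σ := by
  rw [halfEdgeTerm_eq_single x σ (toSite (0, -1)) w_O2_1_0_0_0 (fun γ hγ => absurd (enum_O2_1_0_0 γ) hγ)]
  rw [if_neg (by decide), winding_support_medial w_O2_1_0_0_0.walk (toSite (0, -1)) (by decide),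
    show quarterTurns (List.map ofSite w_O2_1_0_0_0.walk.support ++ [ofSite (toSite (0, -1))]) = 1 from by decide,
    show Literature.Probability.RandomPlanarGeometry.SAW.DomainSAW.length w_O2_1_0_0_0 = 1 from by decide, cexp_quarter_1 σ]
  ring

/-- Value of one half-edge term of the mid-edge observable on the explicit domain (from the enumeration certificate and the integer winding count). [folklore] -/
theorem hET_O2_1_0_S_in (x σ : ℝ) :
    Literature.Probability.RandomPlanarGeometry.SAW.halfEdgeTerm OmO2 1 (toSite (1, 0)) x σ (toSite (0, -1)) (toSite (0, 0)) =
      (x : ℂ) ^ 7 * tOf σ ^ 3 + (x : ℂ) ^ 5 * tOf σ ^ 3 := by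
  rw [halfEdgeTerm_eq_pair x σ (toSite (0, 0)) w_O2_1_0_4_0 w_O2_1_0_4_1
    (ne_of_apply_ne (fun γ => List.map ofSite γ.walk.support) (by decide))
    (fun γ h1 h2 => by
      rcases enum_O2_1_0_4 γ with rfl | rfl | rfl
      · exact absurd rfl h1
      · exact absurd rfl h2
      · decide)]
  rw [if_neg (by decide), if_neg (by decide),
    winding_support_medial w_O2_1_0_4_0.walk (toSite (0, 0)) (by decide),
    winding_support_medial w_O2_1_0_4_1.walk (toSite (0, 0)) (by decide),
    show quarterTurns (List.map ofSite w_O2_1_0_4_0.walk.support ++ [ofSite (toSite (0, 0))]) = 3 from by decide,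
    show quarterTurns (List.map ofSite w_O2_1_0_4_1.walk.support ++ [ofSite (toSite (0, 0))]) = 3 from by decide,
    show Literature.Probability.RandomPlanarGeometry.SAW.DomainSAW.length w_O2_1_0_4_0 = 6 from by decide, show Literature.Probability.RandomPlanarGeometry.SAW.DomainSAW.length w_O2_1_0_4_1 = 4 from by decide,
    cexp_quarter_3 σ]
  ring

/-- Value of the mid-edge observable at one of the four edges at the origin, on the explicit domain. [folklore] -/
theorem F_O2_1_0_E (x σ : ℝ) :
    Literature.Probability.RandomPlanarGeometry.SAW.midEdgeParafermionicObservable OmO2 1 (toSite (1, 0)) x σ s(toSite (0, 0), toSite (1, 0)) =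
      (x : ℂ) := by
  simp only [Literature.Probability.RandomPlanarGeometry.SAW.midEdgeParafermionicObservable_mk, hET_O2_1_0_E_out, hET_O2_1_0_E_in, zero_add]

/-- Value of the mid-edge observable at one of the four edges at the origin, on the explicit domain. [folklore] -/
theorem F_O2_1_0_N (x σ : ℝ) :
    Literature.Probability.RandomPlanarGeometry.SAW.midEdgeParafermionicObservable OmO2 1 (toSite (1, 0)) x σ s(toSite (0, 0), toSite (0, 1)) =
      (x : ℂ) ^ 2 * (tOf σ)⁻¹ + (x : ℂ) ^ 5 * (tOf σ)⁻¹ ^ 3 + (x : ℂ) ^ 7 * (tOf σ)⁻¹ ^ 3 := by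
  simp only [Literature.Probability.RandomPlanarGeometry.SAW.midEdgeParafermionicObservable_mk, hET_O2_1_0_N_out, hET_O2_1_0_N_in, add_assoc]

/-- Value of the mid-edge observable at one of the four edges at the origin, on the explicit domain. [folklore] -/
theorem F_O2_1_0_W (x σ : ℝ) :
    Literature.Probability.RandomPlanarGeometry.SAW.midEdgeParafermionicObservable OmO2 1 (toSite (1, 0)) x σ s(toSite (0, 0), toSite (-1, 0)) =
      (x : ℂ) ^ 2 + (x : ℂ) ^ 5 * tOf σ ^ 2 + (x : ℂ) ^ 5 * (tOf σ)⁻¹ ^ 2 := by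
  simp only [Literature.Probability.RandomPlanarGeometry.SAW.midEdgeParafermionicObservable_mk, hET_O2_1_0_W_out, hET_O2_1_0_W_in, add_assoc]

/-- Value of the mid-edge observable at one of the four edges at the origin, on the explicit domain. [folklore] -/
theorem F_O2_1_0_S (x σ : ℝ) :
    Literature.Probability.RandomPlanarGeometry.SAW.midEdgeParafermionicObservable OmO2 1 (toSite (1, 0)) x σ s(toSite (0, 0), toSite (0, -1)) =
      (x : ℂ) ^ 2 * tOf σ + (x : ℂ) ^ 7 * tOf σ ^ 3 + (x : ℂ) ^ 5 * tOf σ ^ 3 := by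
  simp only [Literature.Probability.RandomPlanarGeometry.SAW.midEdgeParafermionicObservable_mk, hET_O2_1_0_S_out, hET_O2_1_0_S_in, add_assoc]


end NoVertexRelation

/-- **Named fact `NoExactVertexRelationZ2SC` (the barrier's technique class is empty already on
compact star-shaped domains).** There are NO fugacity `x ∈ (0, 1)`, spin `σ` and non-zero
vertex-independent stencil `c : Fin 4 → ℂ` such that `Σᵢ cᵢ F({v, v + dirᵢ}) = 0` holds for the
uniform square-lattice mid-edge observable `F` at every interior vertex `v` of every discrete
domain `Ω_δ` cut out by a COMPACT plane set `Ω` STAR-SHAPED about `δv` (in particular simply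
connected), for every boundary root `a`. The inner hypothesis asks LESS than
`ExactVertexRelationZ2` (all plane sets), so this statement is STRONGER than Appendix A's
`not_hasExactVertexRelationZ2` (`not_hasExactVertexRelationZ2_of_SC`); it is PROVED below
(`NoExactVertexRelationZ2SC_holds`). [cite: DuminilCopinSmirnov2012, Lemma 1 (shape of the relation)] -/
def NoExactVertexRelationZ2SC : Prop :=
  ¬ ∃ (x σ : ℝ) (c : Fin 4 → ℂ), 0 < x ∧ x < 1 ∧ c ≠ 0 ∧
    ∀ (Ω : Set ℂ) (δ : ℝ) (a v : Site 2), IsCompact Ω → StarConvex ℝ (meshPoint δ v) Ω → 0 < δ →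
      a ∈ meshDomain Ω δ → (∃ w : Site 2, (zdGraph 2).Adj a w ∧ meshPoint δ w ∉ Ω) →
      (∀ i : Fin 4, (discreteDomainGraph Ω δ).Adj v (v + dirZ2 i)) →
        ∑ i : Fin 4, c i * Literature.Probability.RandomPlanarGeometry.SAW.midEdgeParafermionicObservable Ω δ a x σ
          s(v, v + dirZ2 i) = 0

-- the theorem below refutes the record `HasExactVertexRelationZ2` of the parent module (marked
-- `@[deprecated]` there by the verdict clean-up of 2026-08-16) and must name it:
-- `linter.deprecated` is off for it alone (a no-op while the parent's attribute has not landed)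
set_option linter.deprecated false in
/-- Monotonicity: the star-shaped statement implies Appendix A's `¬ HasExactVertexRelationZ2` (a
relation valid on all plane sets is in particular valid on the compact star-shaped ones). This is a
second refutation of the deprecated record `HasExactVertexRelationZ2` and names it on purpose.
[folklore] -/
theorem not_hasExactVertexRelationZ2_of_SC (h : NoExactVertexRelationZ2SC) : ¬ HasExactVertexRelationZ2 := by
  rintro ⟨x, σ, c, hx0, hx1, hc, hrel⟩
  exact h ⟨x, σ, c, hx0, hx1, hc, fun Ω δ a v _ _ hδ ha hb hv => hrel Ω δ a v hδ ha hb hv⟩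

open NoVertexRelation in
/-- **Discharge of `NoExactVertexRelationZ2SC`** (second barrier audit). Instances: the plus `P`
(four roots; forces the Cauchy–Riemann stencil), the closed unit squares `Q = [-1,0]×[0,1]`,
`Q̄ = [-1,0]×[-1,0]` and the closed rectangle `O₂ = [-1,0]×[-1,1]`, each with its pendant unit
edges at `v = 0` and rooted at the leaf `E = (1,0)`: `Q − P` and `Q̄ − P` are `x⁵` times the
adjacent-return rows `(0, t⁻³, t², 0)·c`, `(0, 0, t⁻², t³)·c`, and `O₂ − P − x⁵·[(Q−P)+(Q̄−P)]/x⁵`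
is `x⁷` times the opposite-return row `(0, t⁻³, 0, t³)·c` — exactly the `T`- and `O`-rows of
Appendix A, so `vertexStencil_eq_zero_of_rows` applies verbatim. [folklore] -/
theorem NoExactVertexRelationZ2SC_holds : NoExactVertexRelationZ2SC := by
  rintro ⟨x, σ, c, hx0, hx1, hc, hrel⟩
  have hx0' : (x : ℂ) ≠ 0 := by exact_mod_cast hx0.ne'
  -- domain `P` (the plus), four roots
  have hP0 := hrel (Omega PE) 1 (toSite (1, 0)) (toSite (0, 0)) isCompact_OmP starConvex_OmP one_pos
    ((goodP.mem_meshDomain_iff _).2 (by decide))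
    ⟨toSite (2, 0), zdAdj_toSite_right (1, 0), by
      rw [meshPoint_one_toSite, pt_mem_Omega_iff goodP.unit]; decide⟩
    (adj_four goodP (by decide) (by decide) (by decide) (by decide))
  rw [sum_four_dirZ2, F_P_1_0_E, F_P_1_0_N, F_P_1_0_W, F_P_1_0_S] at hP0
  have hP1 := hrel (Omega PE) 1 (toSite (0, 1)) (toSite (0, 0)) isCompact_OmP starConvex_OmP one_pos
    ((goodP.mem_meshDomain_iff _).2 (by decide))
    ⟨toSite (0, 2), zdAdj_toSite_up (0, 1), by
      rw [meshPoint_one_toSite, pt_mem_Omega_iff goodP.unit]; decide⟩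
    (adj_four goodP (by decide) (by decide) (by decide) (by decide))
  rw [sum_four_dirZ2, F_P_0_1_E, F_P_0_1_N, F_P_0_1_W, F_P_0_1_S] at hP1
  have hP2 := hrel (Omega PE) 1 (toSite (-1, 0)) (toSite (0, 0)) isCompact_OmP starConvex_OmP one_pos
    ((goodP.mem_meshDomain_iff _).2 (by decide))
    ⟨toSite (-2, 0), zdAdj_toSite_left (-1, 0), by
      rw [meshPoint_one_toSite, pt_mem_Omega_iff goodP.unit]; decide⟩
    (adj_four goodP (by decide) (by decide) (by decide) (by decide))
  rw [sum_four_dirZ2, F_P_m1_0_E, F_P_m1_0_N, F_P_m1_0_W, F_P_m1_0_S] at hP2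
  have hP3 := hrel (Omega PE) 1 (toSite (0, -1)) (toSite (0, 0)) isCompact_OmP starConvex_OmP one_pos
    ((goodP.mem_meshDomain_iff _).2 (by decide))
    ⟨toSite (0, -2), zdAdj_toSite_down (0, -1), by
      rw [meshPoint_one_toSite, pt_mem_Omega_iff goodP.unit]; decide⟩
    (adj_four goodP (by decide) (by decide) (by decide) (by decide))
  rw [sum_four_dirZ2, F_P_0_m1_E, F_P_0_m1_N, F_P_0_m1_W, F_P_0_m1_S] at hP3
  -- domains `Q`, `Q̄`, `O₂`, root `(1, 0)`
  have hQ := hrel OmQ 1 (toSite (1, 0)) (toSite (0, 0)) isCompact_OmQ starConvex_OmQ one_pos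
    ((goodQ.mem_meshDomain_iff _).2 (by decide))
    ⟨toSite (2, 0), zdAdj_toSite_right (1, 0), by rw [meshPoint_one_toSite, goodQ.pt_mem_iff]; decide⟩
    (goodQ.adj_four (by decide) (by decide) (by decide) (by decide))
  rw [sum_four_dirZ2, F_Q_1_0_E, F_Q_1_0_N, F_Q_1_0_W, F_Q_1_0_S] at hQ
  have hQb := hrel OmQb 1 (toSite (1, 0)) (toSite (0, 0)) isCompact_OmQb starConvex_OmQb one_pos
    ((goodQb.mem_meshDomain_iff _).2 (by decide))
    ⟨toSite (2, 0), zdAdj_toSite_right (1, 0), by rw [meshPoint_one_toSite, goodQb.pt_mem_iff]; decide⟩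
    (goodQb.adj_four (by decide) (by decide) (by decide) (by decide))
  rw [sum_four_dirZ2, F_Qb_1_0_E, F_Qb_1_0_N, F_Qb_1_0_W, F_Qb_1_0_S] at hQb
  have hO := hrel OmO2 1 (toSite (1, 0)) (toSite (0, 0)) isCompact_OmO2 starConvex_OmO2 one_pos
    ((goodO2.mem_meshDomain_iff _).2 (by decide))
    ⟨toSite (2, 0), zdAdj_toSite_right (1, 0), by rw [meshPoint_one_toSite, goodO2.pt_mem_iff]; decide⟩
    (goodO2.adj_four (by decide) (by decide) (by decide) (by decide))
  rw [sum_four_dirZ2, F_O2_1_0_E, F_O2_1_0_N, F_O2_1_0_W, F_O2_1_0_S] at hO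
  -- the loop rows of Appendix A, recovered from the star-shaped instances
  have hT : c 1 * (tOf σ)⁻¹ ^ 3 + c 2 * tOf σ ^ 2 = 0 := by
    have h : (x : ℂ) ^ 5 * (c 1 * (tOf σ)⁻¹ ^ 3 + c 2 * tOf σ ^ 2) = 0 := by
      linear_combination hQ - hP0
    exact (mul_eq_zero.1 h).resolve_left (pow_ne_zero 5 hx0')
  have hTb : c 2 * (tOf σ)⁻¹ ^ 2 + c 3 * tOf σ ^ 3 = 0 := by
    have h : (x : ℂ) ^ 5 * (c 2 * (tOf σ)⁻¹ ^ 2 + c 3 * tOf σ ^ 3) = 0 := by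
      linear_combination hQb - hP0
    exact (mul_eq_zero.1 h).resolve_left (pow_ne_zero 5 hx0')
  have hO' : c 1 * (tOf σ)⁻¹ ^ 3 + c 3 * tOf σ ^ 3 = 0 := by
    have h : (x : ℂ) ^ 7 * (c 1 * (tOf σ)⁻¹ ^ 3 + c 3 * tOf σ ^ 3) = 0 := by
      linear_combination hO - hP0 - (x : ℂ) ^ 5 * hT - (x : ℂ) ^ 5 * hTb
    exact (mul_eq_zero.1 h).resolve_left (pow_ne_zero 7 hx0')
  exact hc (vertexStencil_eq_zero_of_rows x hx0 hx1 (tOf σ) (norm_tOf σ) c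
    (by linear_combination hP0) (by linear_combination hP1) (by linear_combination hP2)
    (by linear_combination hP3) hT hO')

end StarConvexEmpty

end Literature.Barriers.CriticalPhenomena
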